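import Literature.NumberTheory.Sieve.LargeSieveCharacters
import Literature.NumberTheory.Sieve.RamanujanSum
import Literature.NumberTheory.Sieve.GoldbachSingularSeriesSum
import HarnessLib

/-!
# Montgomery–Vaughan (1975), §5: Gauss sums, the sums `c_χ(m)`, and LEMMA 5.5

H. L. Montgomery, R. C. Vaughan, *The exceptional set in Goldbach's problem*, Acta Arith. 27 (1975)
353–370 [MontgomeryVaughanActa1975], §5 "Arithmetic lemmas", pp. 358–361.  Everything in this file
is PROVED; it is the arithmetic input of the major-arc formulae (6.17)/(6.17~) (the named fact
`Literature.MontgomeryVaughan1975.majorArc_formula` of `MontgomeryVaughan1975MajorArcs.lean`).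

Notation: `χ (mod q)` a character, `χ* (mod r)` the primitive character inducing it (Mathlib:
`χ = changeLevel _ χ*`), `τ(χ) = ∑_h χ(h) e(h/q)` (`gaussSum χ ZMod.stdAddChar`),
`c_χ(m) = ∑_h χ(h) e(hm/q)` (2.1) (`charGauss χ m`, the Gauss sum against the shifted standard
additive character), `c_q(m) = c_{χ₀}(m)` Ramanujan's sum, `q₁ = q/(q, m)` (`redMod`),
`m₁ = m/(q, m)` (`redArg`).

* LEMMA 5.1 (first half, `|τ(χ)| = q^{1/2}` for primitive `χ`) is the tree's
  `Literature.NumberTheory.Sieve.LargeSieve.norm_gaussSum_sq`; the second half is in `MontgomeryVaughan1975MajorArcs`.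
* `gaussSum_changeLevel` — **LEMMA 5.2**: `τ(χ) = μ(q/r) χ*(q/r) τ(χ*)` (Möbius over `(h, q) = 1`,
  then `∑_{j<rt} χ*(j) e(j/(rt)) = 0` for `t ≥ 2`); `norm_gaussSum_changeLevel_sq`.
* `charGauss_of_isPrimitive` — **LEMMA 5.3** / primitivity: `c_χ(a) = χ̄(a) τ(χ)` for all `a`
  (Mathlib's `gaussSum_mulShift_of_isPrimitive`).
* `charGauss_changeLevel` — **LEMMA 5.4**, formula **(5.1)**:
  `c_χ(m) = χ̄*(m₁) (φ(q)/φ(q₁)) μ(q₁/r) χ*(q₁/r) τ(χ*)` if `r ∣ q₁`, and `0` if `r ∤ q₁`, proved as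
  printed (fibres of `(ℤ/q)ˣ → (ℤ/q₁)ˣ`: `charGauss_eq_sum_fibers`,
  `sum_fiber_eq_zero_of_not_factorsThrough` (Case 1), `card_fiber_mul_totient`,
  `sum_fiber_changeLevel` (Case 2)); `norm_charGauss_changeLevel_le`
  (`|c_χ(m)| ≤ [r ∣ q₁] (φ(q)/φ(q₁)) r^{1/2}`); `charGauss_one_eq` — **(5.2)**
  `c_q(m) = μ(q₁) φ(q)/φ(q₁)` (von Sterneck).
* `lemma55` — **LEMMA 5.5**, (5.4): for primitive `χᵢ (mod rᵢ)` and `m ≥ 1`,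
  `∑_q φ(q)⁻² |c_{χ₁χ₂χ₀}(m) τ(χ̄₁χ₀) τ(χ̄₂χ₀)| ≤ 4e² m/φ(m)` over any finite set of moduli `q`
  (`lemma55Term`), through `lemma55Term_le` (one modulus `q = r₄k`: LEMMA 5.4, LEMMA 5.2,
  `(k, r₄) = 1`, `μ(k)² = 1`), `lemma55_local`/`lemma55_moduli` (the prime-by-prime bound
  `(r₁r₂r₃)^{1/2} φ(r₄)⁻¹ φ(r₄/r₅)⁻¹ ≤ 4 ∏_{p ∣ r₅} (1 - 1/p)⁻¹`) and `sum_lemma55Weight_le` (the sum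
  over `k`, via the tree's `Literature.NumberTheory.Sieve.GoldbachSeries.sum_range_le_prod_primesBelow`).
-/

noncomputable section

open Finset Classical
open scoped ArithmeticFunction.Moebius FourierTransform

namespace Literature.NumberTheory.Sieve.MontgomeryVaughan1975

/-! ### Sums over `range q` versus sums over `ZMod q` -/

/-- A sum over the residues `0 ≤ j < q` is a sum over `ZMod q`. [folklore] -/
theorem sum_range_eq_sum_zmod {q : ℕ} [NeZero q] (F : ZMod q → ℂ) :
    ∑ j ∈ Finset.range q, F (j : ZMod q) = ∑ x : ZMod q, F x := by
  refine Finset.sum_bij (fun (j : ℕ) _ => (j : ZMod q)) (fun _ _ => Finset.mem_univ _) ?_ ?_ ?_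
  · intro a ha b hb h
    have ha' := Finset.mem_range.mp ha
    have hb' := Finset.mem_range.mp hb
    have := congrArg ZMod.val h
    rwa [ZMod.val_natCast, ZMod.val_natCast, Nat.mod_eq_of_lt ha', Nat.mod_eq_of_lt hb'] at this
  · intro x _
    exact ⟨x.val, Finset.mem_range.mpr (ZMod.val_lt x), by simp⟩
  · intro a _; rfl

/-- `e(j/q)` is the standard additive character of `ZMod q` at `j`. [folklore] -/
theorem fourierChar_div_eq_stdAddChar' {q : ℕ} [NeZero q] (j : ℤ) :
    (𝐞 ((j : ℝ) / q) : ℂ) = ZMod.stdAddChar ((j : ℤ) : ZMod q) := by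
  rw [ZMod.stdAddChar_coe, Real.fourierChar_apply]
  congr 1
  push_cast
  ring

/-- The Gauss sum `τ(χ) = ∑_{h mod q} χ(h) e(h/q)` as a sum over `0 ≤ h < q`. [folklore] -/
theorem gaussSum_eq_sum_range {q : ℕ} [NeZero q] (χ : DirichletCharacter ℂ q) :
    gaussSum χ ZMod.stdAddChar = ∑ j ∈ Finset.range q, χ (j : ZMod q) * (𝐞 ((j : ℝ) / q) : ℂ) := by
  rw [gaussSum, ← sum_range_eq_sum_zmod]
  refine Finset.sum_congr rfl fun j _ => ?_
  rw [show ((j : ℝ) / q) = ((j : ℤ) : ℝ) / q by push_cast; ring, fourierChar_div_eq_stdAddChar']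
  push_cast
  rfl

/-! ### Splitting `0 ≤ j < rt` as `j = j₀ + r u` -/

/-- `∑_{j < r t} f(j) = ∑_{j₀ < r} ∑_{u < t} f(j₀ + r u)`. [folklore] -/
theorem sum_range_mul_eq (f : ℕ → ℂ) (r t : ℕ) :
    ∑ j ∈ Finset.range (r * t), f j = ∑ j₀ ∈ Finset.range r, ∑ u ∈ Finset.range t, f (j₀ + r * u) := by
  induction t with
  | zero => simp
  | succ t ih =>
    rw [show r * (t + 1) = r * t + r by ring, Finset.sum_range_add, ih]
    simp_rw [Finset.sum_range_succ]
    rw [Finset.sum_add_distrib]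
    congr 1
    refine Finset.sum_congr rfl fun j₀ _ => ?_
    congr 1; ring

/-- For a character `ψ (mod r)` and `t ≥ 2`: `∑_{j < rt} ψ(j) e(j/(rt)) = 0` (the inner sum over
`u (mod t)` of `e(u/t)` vanishes); the Gauss sum of a character induced to a modulus `rt` with an
extra factor sees only this. [folklore] -/
theorem sum_range_mul_char_fourierChar_eq_zero {r : ℕ} [NeZero r] (ψ : DirichletCharacter ℂ r)
    {t : ℕ} (ht : 2 ≤ t) :
    ∑ j ∈ Finset.range (r * t), ψ (j : ZMod r) * (𝐞 ((j : ℝ) / ((r * t : ℕ) : ℝ)) : ℂ) = 0 := by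
  rw [sum_range_mul_eq]
  refine Finset.sum_eq_zero fun j₀ _ => ?_
  have ht0 : (t : ℝ) ≠ 0 := by exact_mod_cast (show t ≠ 0 by omega)
  have hr0 : (r : ℝ) ≠ 0 := by exact_mod_cast NeZero.ne r
  have hterm : ∀ u : ℕ, ψ (((j₀ + r * u : ℕ)) : ZMod r) * (𝐞 (((j₀ + r * u : ℕ) : ℝ) / ((r * t : ℕ) : ℝ)) : ℂ) =
      ψ (j₀ : ZMod r) * (𝐞 ((j₀ : ℝ) / ((r * t : ℕ) : ℝ)) : ℂ) * (𝐞 ((u : ℝ) * (1 : ℤ) / t) : ℂ) := by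
    intro u
    have h1 : (((j₀ + r * u : ℕ)) : ZMod r) = (j₀ : ZMod r) := by
      push_cast; simp
    have h2 : (((j₀ + r * u : ℕ) : ℝ) / ((r * t : ℕ) : ℝ)) = (j₀ : ℝ) / ((r * t : ℕ) : ℝ) + (u : ℝ) * (1 : ℤ) / t := by
      push_cast; field_simp
    rw [h1, h2, AddChar.map_add_eq_mul, Circle.coe_mul, mul_assoc]
  simp_rw [hterm, ← Finset.mul_sum]
  rw [Literature.NumberTheory.Sieve.RamanujanSum.sum_range_fourierChar_div (by omega) 1]
  have : ¬ ((t : ℤ) ∣ 1) := by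
    intro h
    have := Int.eq_one_of_dvd_one (by positivity) h
    omega
  rw [if_neg this, mul_zero]

/-! ### LEMMA 5.2: the Gauss sum of an induced character -/

/-- Values of an induced character on integers: `(ψχ₀)(j) = ψ(j)` if `(j, q) = 1` and `0` otherwise.
[folklore] -/
theorem changeLevel_apply_natCast {r q : ℕ} [NeZero q] (h : r ∣ q) (ψ : DirichletCharacter ℂ r)
    (j : ℕ) :
    DirichletCharacter.changeLevel h ψ (j : ZMod q) =
      if j.Coprime q then ψ (j : ZMod r) else 0 := by
  split_ifs with hj
  · have := DirichletCharacter.changeLevel_eq_cast_of_dvd' ψ h (a := (j : ℤ))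
      (Nat.isCoprime_iff_coprime.mpr hj)
    push_cast at this
    exact this
  · exact MulChar.map_nonunit _ (mt (ZMod.isUnit_iff_coprime j q).mp hj)

/-- `∑_{d ∣ n} μ(d) = [n = 1]` in `ℂ`. [folklore] -/
theorem sum_divisors_moebius_eq (n : ℕ) :
    ∑ d ∈ n.divisors, (μ d : ℂ) = if n = 1 then 1 else 0 := by
  have h := congrArg (fun f : ArithmeticFunction ℂ => f n)
    (ArithmeticFunction.coe_moebius_mul_coe_zeta (R := ℂ))
  simp only [ArithmeticFunction.coe_mul_zeta_apply, ArithmeticFunction.intCoe_apply,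
    ArithmeticFunction.one_apply] at h
  exact h

/-- The indicator of `(j, q) = 1` by Möbius inversion: `[gcd(j, q) = 1] = ∑_{d ∣ gcd(j,q)} μ(d)`.
[folklore] -/
theorem coprime_indicator_eq_sum_moebius (j q : ℕ) :
    (if j.Coprime q then (1 : ℂ) else 0) = ∑ d ∈ (Nat.gcd j q).divisors, (μ d : ℂ) := by
  rw [sum_divisors_moebius_eq]

/-- Multiples of `d ∣ q` below `q`: `{j < q : d ∣ j} = {d i : i < q/d}`. [folklore] -/
theorem filter_range_dvd_eq_image {q d : ℕ} (hd : d ∣ q) (hd0 : d ≠ 0) :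
    (Finset.range q).filter (fun j => d ∣ j) = (Finset.range (q / d)).image (fun i => d * i) := by
  obtain ⟨k, rfl⟩ := hd
  have hdpos : 0 < d := Nat.pos_of_ne_zero hd0
  rw [Nat.mul_div_cancel_left k hdpos]
  ext j
  simp only [Finset.mem_filter, Finset.mem_range, Finset.mem_image]
  constructor
  · rintro ⟨hj, ⟨i, rfl⟩⟩
    exact ⟨i, (Nat.mul_lt_mul_left hdpos).mp hj, rfl⟩
  · rintro ⟨i, hi, rfl⟩
    exact ⟨(Nat.mul_lt_mul_left hdpos).mpr hi, dvd_mul_right d i⟩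

/-- `(d i)/q = i/(q/d)` for `d ∣ q`, `d ≠ 0`. [folklore] -/
theorem mul_div_eq_div_div {q d : ℕ} (hd : d ∣ q) (hd0 : d ≠ 0) (i : ℕ) :
    ((d * i : ℕ) : ℝ) / q = (i : ℝ) / ((q / d : ℕ) : ℝ) := by
  obtain ⟨k, rfl⟩ := hd
  rw [Nat.mul_div_cancel_left k (Nat.pos_of_ne_zero hd0)]
  have : (d : ℝ) ≠ 0 := by exact_mod_cast hd0
  push_cast
  rcases eq_or_ne k 0 with hk | hk
  · subst hk; simp
  · have hk' : (k : ℝ) ≠ 0 := by exact_mod_cast hk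
    field_simp

/-- The character sum `G_ψ(K) = ∑_{i < K} ψ(i) e(i/K)` of a character `ψ (mod r)` along a multiple
`K` of `r` (for `K = r` this is `τ(ψ)`, for `K = rt`, `t ≥ 2`, it vanishes). [folklore] -/
def charSumAlong {r : ℕ} (ψ : DirichletCharacter ℂ r) (K : ℕ) : ℂ :=
  ∑ i ∈ Finset.range K, ψ (i : ZMod r) * (𝐞 ((i : ℝ) / K) : ℂ)

/-- **Möbius expansion of the Gauss sum of an induced character**: for `χ = ψχ₀ (mod q)` induced by
`ψ (mod r)`, `r ∣ q`,  `τ(χ) = ∑_{d ∣ q} μ(d) ψ(d) G_ψ(q/d)` with `G_ψ(K) = ∑_{i<K} ψ(i) e(i/K)`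
(insert `[(h,q)=1] = ∑_{d ∣ (h,q)} μ(d)` and substitute `h = d i`). [folklore] -/
theorem gaussSum_changeLevel_eq_sum_divisors {r q : ℕ} [NeZero q] [NeZero r] (h : r ∣ q)
    (ψ : DirichletCharacter ℂ r) :
    gaussSum (DirichletCharacter.changeLevel h ψ) ZMod.stdAddChar =
      ∑ d ∈ q.divisors, (μ d : ℂ) * ψ (d : ZMod r) * charSumAlong ψ (q / d) := by
  rw [gaussSum_eq_sum_range]
  -- insert the Möbius indicator
  have step1 : ∀ j ∈ Finset.range q,
      DirichletCharacter.changeLevel h ψ (j : ZMod q) * (𝐞 ((j : ℝ) / q) : ℂ) =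
        ∑ d ∈ (Nat.gcd j q).divisors, (μ d : ℂ) * (ψ (j : ZMod r) * (𝐞 ((j : ℝ) / q) : ℂ)) := by
    intro j _
    rw [changeLevel_apply_natCast, ← Finset.sum_mul, ← coprime_indicator_eq_sum_moebius]
    split_ifs <;> simp
  rw [Finset.sum_congr rfl step1]
  -- swap the sums
  have hswap : ∑ j ∈ Finset.range q, ∑ d ∈ (Nat.gcd j q).divisors,
      (μ d : ℂ) * (ψ (j : ZMod r) * (𝐞 ((j : ℝ) / q) : ℂ)) =
      ∑ d ∈ q.divisors, ∑ j ∈ (Finset.range q).filter (fun j => d ∣ j),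
        (μ d : ℂ) * (ψ (j : ZMod r) * (𝐞 ((j : ℝ) / q) : ℂ)) := by
    refine Finset.sum_comm' ?_
    intro j d
    simp only [Finset.mem_range, Nat.mem_divisors, Finset.mem_filter, Nat.dvd_gcd_iff]
    constructor
    · rintro ⟨hj, ⟨hdj, hdq⟩, _⟩
      exact ⟨⟨hj, hdj⟩, hdq, NeZero.ne q⟩
    · rintro ⟨⟨hj, hdj⟩, hdq, hq⟩
      exact ⟨hj, ⟨hdj, hdq⟩, Nat.gcd_ne_zero_right hq⟩
  rw [hswap]
  refine Finset.sum_congr rfl fun d hd => ?_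
  have hd' := Nat.mem_divisors.mp hd
  have hd0 : d ≠ 0 := ne_zero_of_dvd_ne_zero hd'.2 hd'.1
  rw [← Finset.mul_sum, filter_range_dvd_eq_image hd'.1 hd0, Finset.sum_image]
  swap
  · intro i _ i' _ hii'
    exact Nat.eq_of_mul_eq_mul_left (Nat.pos_of_ne_zero hd0) hii'
  unfold charSumAlong
  rw [Finset.mul_sum, Finset.mul_sum]
  refine Finset.sum_congr rfl fun i _ => ?_
  rw [mul_div_eq_div_div hd'.1 hd0 i]
  push_cast
  rw [map_mul]
  ring

/-- `G_ψ(r) = τ(ψ)`. [folklore] -/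
theorem charSumAlong_self {r : ℕ} [NeZero r] (ψ : DirichletCharacter ℂ r) :
    charSumAlong ψ r = gaussSum ψ ZMod.stdAddChar := by
  rw [gaussSum_eq_sum_range]; rfl

/-- `G_ψ(rt) = 0` for `t ≥ 2`. [folklore] -/
theorem charSumAlong_mul {r : ℕ} [NeZero r] (ψ : DirichletCharacter ℂ r) {t : ℕ} (ht : 2 ≤ t) :
    charSumAlong ψ (r * t) = 0 :=
  sum_range_mul_char_fourierChar_eq_zero ψ ht

/-- A character value `ψ(d) ≠ 0` forces `(d, r) = 1`. [folklore] -/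
theorem coprime_of_apply_ne_zero {r : ℕ} (ψ : DirichletCharacter ℂ r) {d : ℕ}
    (h : ψ (d : ZMod r) ≠ 0) : d.Coprime r := by
  by_contra hc
  exact h (MulChar.map_nonunit _ (mt (ZMod.isUnit_iff_coprime d r).mp hc))

/-- **LEMMA 5.2** (Montgomery–Vaughan 1975, p. 358; Davenport, *Multiplicative Number Theory*,
p. 148): if `χ (mod q)` is induced by the character `χ* (mod r)`, `r ∣ q`, then
`τ(χ) = μ(q/r) χ*(q/r) τ(χ*)`.  (Valid for any inducing `χ*`, primitive or not.)  Proof: in the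
Möbius expansion `τ(χ) = ∑_{d ∣ q} μ(d) χ*(d) G(q/d)`, a term with `χ*(d) ≠ 0` has `(d, r) = 1`,
so `q/d = rt`, and `G(rt) = 0` unless `t = 1`, i.e. `d = q/r`, where `G(r) = τ(χ*)`.
[cite: MontgomeryVaughanActa1975, §5 Lemma 5.2] -/
theorem gaussSum_changeLevel {r q : ℕ} [NeZero q] [NeZero r] (h : r ∣ q)
    (ψ : DirichletCharacter ℂ r) :
    gaussSum (DirichletCharacter.changeLevel h ψ) ZMod.stdAddChar =
      (μ (q / r) : ℂ) * ψ ((q / r : ℕ) : ZMod r) * gaussSum ψ ZMod.stdAddChar := by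
  have hq0 : q ≠ 0 := NeZero.ne q
  have hr0 : 0 < r := Nat.pos_of_ne_zero (NeZero.ne r)
  rw [gaussSum_changeLevel_eq_sum_divisors h ψ]
  have hqr : q / r ∈ q.divisors := Nat.mem_divisors.mpr ⟨Nat.div_dvd_of_dvd h, hq0⟩
  rw [← Finset.sum_erase_add _ _ hqr, Nat.div_div_self h hq0, charSumAlong_self]
  suffices hzero : ∑ d ∈ q.divisors.erase (q / r), (μ d : ℂ) * ψ (d : ZMod r) * charSumAlong ψ (q / d) = 0 by
    rw [hzero, zero_add]
  refine Finset.sum_eq_zero fun d hd => ?_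
  obtain ⟨hne, hd⟩ := Finset.mem_erase.mp hd
  have hdq : d ∣ q := (Nat.mem_divisors.mp hd).1
  by_cases hψ : ψ (d : ZMod r) = 0
  · rw [hψ, mul_zero, zero_mul]
  · -- `(d, r) = 1`, so `rd ∣ q` and `q/d = r t` with `t ≥ 2`
    have hcop : d.Coprime r := coprime_of_apply_ne_zero ψ hψ
    have hrd : r * d ∣ q := Nat.Coprime.mul_dvd_of_dvd_of_dvd hcop.symm h hdq
    obtain ⟨t, ht⟩ := hrd
    have hd0 : 0 < d := Nat.pos_of_ne_zero (ne_zero_of_dvd_ne_zero hq0 hdq)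
    have hqd : q / d = r * t := by
      rw [ht, show r * d * t = d * (r * t) by ring, Nat.mul_div_cancel_left _ hd0]
    have ht2 : 2 ≤ t := by
      rcases Nat.lt_or_ge t 2 with hlt | hge
      · interval_cases t
        · exact absurd (by rw [ht]; ring) hq0
        · exfalso; apply hne
          rw [ht, mul_one, Nat.mul_div_cancel_left _ hr0]
      · exact hge
    rw [hqd, charSumAlong_mul ψ ht2, mul_zero]

/-- **LEMMA 5.2, in absolute value** with **LEMMA 5.1** (first half; Montgomery–Vaughan 1975,
p. 358: `|τ(χ)| = q^{1/2}` for primitive `χ (mod q)`): for `χ (mod q)` induced by the PRIMITIVE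
character `χ* (mod r)`, `|τ(χ)|² = r` if `q/r` is squarefree and coprime to `r`, and `τ(χ) = 0`
otherwise; in all cases `|τ(χ)|² ≤ r` and `|τ(χ)|² = μ(q/r)² |χ*(q/r)|² r`.
[cite: MontgomeryVaughanActa1975, §5 Lemmas 5.1–5.2] -/
theorem norm_gaussSum_changeLevel_sq {r q : ℕ} [NeZero q] [NeZero r] (h : r ∣ q)
    {ψ : DirichletCharacter ℂ r} (hψ : ψ.IsPrimitive) :
    ‖gaussSum (DirichletCharacter.changeLevel h ψ) ZMod.stdAddChar‖ ^ 2 =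
      (μ (q / r) : ℝ) ^ 2 * ‖ψ ((q / r : ℕ) : ZMod r)‖ ^ 2 * r := by
  rw [gaussSum_changeLevel h ψ, norm_mul, norm_mul, mul_pow, mul_pow,
    Literature.NumberTheory.Sieve.LargeSieve.norm_gaussSum_sq hψ]
  congr 2
  rw [Complex.norm_intCast, sq_abs]


/-! ### LEMMA 5.4: the sums `c_χ(m)` of an induced character -/

section Lemma54

/-- `c_χ(a) = ∑_{h mod q} χ(h) e(ha/q)` for a residue `a (mod q)`, as the Gauss sum against the
shifted standard additive character (Montgomery–Vaughan 1975, (2.1): `c_χ(m)`, `τ(χ) = c_χ(1)`).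
[cite: MontgomeryVaughanActa1975, §2 (2.1)] -/
def charGauss {q : ℕ} [NeZero q] (χ : DirichletCharacter ℂ q) (a : ZMod q) : ℂ :=
  gaussSum χ (ZMod.stdAddChar.mulShift a)

/-- `c_χ(a) = ∑_x χ(x) e_q(ax)` (definition). [folklore] -/
theorem charGauss_eq_sum {q : ℕ} [NeZero q] (χ : DirichletCharacter ℂ q) (a : ZMod q) :
    charGauss χ a = ∑ x : ZMod q, χ x * ZMod.stdAddChar (a * x) := by
  simp only [charGauss, gaussSum, AddChar.mulShift_apply]

/-- `c_χ(1) = τ(χ)`. [cite: MontgomeryVaughanActa1975, §2 (2.1)] -/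
theorem charGauss_one {q : ℕ} [NeZero q] (χ : DirichletCharacter ℂ q) :
    charGauss χ 1 = gaussSum χ ZMod.stdAddChar := by
  rw [charGauss, AddChar.mulShift_one]

/-- **Primitive characters**: `c_χ(a) = χ̄(a) τ(χ)` for ALL residues `a` (Montgomery–Vaughan 1975,
proof of Lemma 5.3: "`χ*(m) c_χ(m) = χ(m) c_χ(m) = c_χ(1) = τ(χ)`"; for `(a, q) > 1` both sides
vanish, by primitivity — Mathlib's `gaussSum_mulShift_of_isPrimitive`).
[cite: MontgomeryVaughanActa1975, §5 Lemma 5.3] -/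
theorem charGauss_of_isPrimitive {q : ℕ} [NeZero q] {χ : DirichletCharacter ℂ q}
    (hχ : χ.IsPrimitive) (a : ZMod q) : charGauss χ a = χ⁻¹ a * gaussSum χ ZMod.stdAddChar :=
  gaussSum_mulShift_of_isPrimitive _ hχ a

/-- A sum over `ZMod q` of a function vanishing off the units is a sum over the units. [folklore] -/
theorem sum_units_eq_sum {q : ℕ} [NeZero q] (F : ZMod q → ℂ) (hF : ∀ x, ¬ IsUnit x → F x = 0) :
    ∑ u : (ZMod q)ˣ, F u = ∑ x : ZMod q, F x := by
  rw [← Finset.sum_filter_add_sum_filter_not Finset.univ (fun x : ZMod q => IsUnit x),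
    Finset.sum_eq_zero (s := Finset.univ.filter fun x : ZMod q => ¬ IsUnit x)
      (fun x hx => hF x (Finset.mem_filter.mp hx).2), add_zero]
  refine Finset.sum_bij (fun (u : (ZMod q)ˣ) _ => (u : ZMod q)) (fun u _ => by simp)
    (fun u _ v _ h => Units.ext h) (fun x hx => ?_) (fun _ _ => rfl)
  obtain ⟨-, hx⟩ := Finset.mem_filter.mp hx
  exact ⟨hx.unit, Finset.mem_univ _, hx.unit_spec⟩

variable {q : ℕ} [NeZero q]

/-- The standard additive character at `m x` depends on `x` only modulo `q₁ = q/(q, m)`: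
`e_q(mx) = e_{q₁}(m₁ x̄)` with `m₁ = m/(q, m)` (Montgomery–Vaughan 1975, proof of Lemma 5.4:
"`c_χ(m)` is periodic with a period which divides `q` … `m/q = m₁/q₁`"). [cite: MontgomeryVaughanActa1975, §5 Lemma 5.4] -/
theorem stdAddChar_mul_eq {m : ℕ} (hm : m ≠ 0) (x : ZMod q) :
    haveI : NeZero (q / Nat.gcd q m) := ⟨Nat.div_ne_zero_iff_of_dvd (Nat.gcd_dvd_left q m) |>.mpr
      ⟨NeZero.ne q, Nat.gcd_ne_zero_right hm⟩⟩
    ZMod.stdAddChar ((m : ZMod q) * x) =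
      ZMod.stdAddChar (((m / Nat.gcd q m : ℕ) : ZMod (q / Nat.gcd q m)) *
        ZMod.castHom (Nat.div_dvd_of_dvd (Nat.gcd_dvd_left q m)) (ZMod (q / Nat.gcd q m)) x) := by
  set g := Nat.gcd q m with hg
  have hg0 : 0 < g := Nat.gcd_pos_of_pos_left m (Nat.pos_of_ne_zero (NeZero.ne q))
  have hq : q = g * (q / g) := (Nat.mul_div_cancel' (Nat.gcd_dvd_left q m)).symm
  have hmg : m = g * (m / g) := (Nat.mul_div_cancel' (Nat.gcd_dvd_right q m)).symm
  haveI : NeZero (q / g) := ⟨Nat.div_ne_zero_iff_of_dvd (Nat.gcd_dvd_left q m) |>.mpr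
      ⟨NeZero.ne q, Nat.gcd_ne_zero_right hm⟩⟩
  -- write `x = j (mod q)` with `j = x.val`
  have hx : x = ((x.val : ℤ) : ZMod q) := by simp
  have h1 : ((m : ZMod q) * x) = (((m * x.val : ℕ) : ℤ) : ZMod q) := by
    conv_lhs => rw [hx]
    push_cast; ring
  have h2 : (((m / g : ℕ) : ZMod (q / g)) *
      ZMod.castHom (Nat.div_dvd_of_dvd (Nat.gcd_dvd_left q m)) (ZMod (q / g)) x) =
      ((((m / g) * x.val : ℕ) : ℤ) : ZMod (q / g)) := by
    rw [ZMod.castHom_apply, ZMod.cast_eq_val]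
    simp only [Nat.cast_mul, Int.cast_mul, Int.cast_natCast]
  rw [h1, h2, ZMod.stdAddChar_coe, ZMod.stdAddChar_coe]
  congr 1
  have hgC : (g : ℂ) ≠ 0 := by exact_mod_cast hg0.ne'
  have hqC : (q : ℂ) ≠ 0 := by exact_mod_cast NeZero.ne q
  have hq1C : ((q / g : ℕ) : ℂ) ≠ 0 := by exact_mod_cast NeZero.ne (q / g)
  have hqg : (q : ℂ) = g * ((q / g : ℕ) : ℂ) := by exact_mod_cast hq
  have hmg' : (m : ℂ) = g * ((m / g : ℕ) : ℂ) := by exact_mod_cast hmg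
  simp only [Nat.cast_mul, Int.cast_mul, Int.cast_natCast]
  rw [← hg, hqg, hmg']
  field_simp

end Lemma54

section Lemma54Main

variable {q : ℕ} [NeZero q]

/-- `q₁ = q/(q, m)`, the reduced period of `h ↦ e(hm/q)` (Montgomery–Vaughan 1975, Lemma 5.4).
[cite: MontgomeryVaughanActa1975, §5 Lemma 5.4] -/
def redMod (q m : ℕ) : ℕ := q / Nat.gcd q m

/-- `m₁ = m/(q, m)` (Montgomery–Vaughan 1975, proof of Lemma 5.4: `m/q = m₁/q₁`, `(m₁, q₁) = 1`).
[cite: MontgomeryVaughanActa1975, §5 Lemma 5.4] -/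
def redArg (q m : ℕ) : ℕ := m / Nat.gcd q m

/-- `q₁ ∣ q`. [folklore] -/
theorem redMod_dvd (q m : ℕ) : redMod q m ∣ q := Nat.div_dvd_of_dvd (Nat.gcd_dvd_left q m)

omit [NeZero q] in
/-- `q₁ ≠ 0` for `q, m ≠ 0`. [folklore] -/
theorem redMod_ne_zero {m : ℕ} (hq : q ≠ 0) (hm : m ≠ 0) : redMod q m ≠ 0 :=
  (Nat.div_ne_zero_iff_of_dvd (Nat.gcd_dvd_left q m)).mpr ⟨hq, Nat.gcd_ne_zero_right hm⟩

omit [NeZero q] in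
/-- `(m₁, q₁) = 1`. [folklore] -/
theorem coprime_redArg_redMod {m : ℕ} (hq : q ≠ 0) : (redArg q m).Coprime (redMod q m) := by
  unfold redArg redMod
  have := Nat.coprime_div_gcd_div_gcd (m := q) (n := m) (Nat.gcd_pos_of_pos_left m (Nat.pos_of_ne_zero hq))
  exact this.symm

/-- `q = (q, m) q₁`. [folklore] -/
theorem gcd_mul_redMod (q m : ℕ) : Nat.gcd q m * redMod q m = q :=
  Nat.mul_div_cancel' (Nat.gcd_dvd_left q m)

/-- **Step 1 of Lemma 5.4** (Montgomery–Vaughan 1975, (5.3)): `c_χ(m) = ∑_{u} χ(u) e_{q₁}(m₁ ū)`,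
the sum over the units `u` of `ℤ/q`, `ū` the image of `u` in `(ℤ/q₁)ˣ`.
[cite: MontgomeryVaughanActa1975, §5 Lemma 5.4 (5.3)] -/
theorem charGauss_eq_sum_units (χ : DirichletCharacter ℂ q) {m : ℕ} (hm : m ≠ 0)
    [NeZero (redMod q m)] :
    charGauss χ (m : ZMod q) =
      ∑ u : (ZMod q)ˣ, χ u * ZMod.stdAddChar (((redArg q m : ℕ) : ZMod (redMod q m)) *
        ((ZMod.unitsMap (redMod_dvd q m) u : (ZMod (redMod q m))ˣ) : ZMod (redMod q m))) := by
  rw [charGauss_eq_sum, ← sum_units_eq_sum (fun x => χ x * ZMod.stdAddChar ((m : ZMod q) * x))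
    (fun x hx => by rw [MulChar.map_nonunit χ hx, zero_mul])]
  refine Finset.sum_congr rfl fun u _ => ?_
  congr 1
  rw [stdAddChar_mul_eq hm]
  congr 2

/-- **Step 2 of Lemma 5.4**: grouping the units `u (mod q)` by their image `y (mod q₁)`,
`c_χ(m) = ∑_{y ∈ (ℤ/q₁)ˣ} e_{q₁}(m₁ y) S(y)` with `S(y) = ∑_{u ↦ y} χ(u)` (Montgomery–Vaughan 1975,
(5.3): `c_χ(m) = ∑'_b e(bm₁/q₁) S(b)`). [cite: MontgomeryVaughanActa1975, §5 Lemma 5.4 (5.3)] -/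
theorem charGauss_eq_sum_fibers (χ : DirichletCharacter ℂ q) {m : ℕ} (hm : m ≠ 0)
    [NeZero (redMod q m)] :
    charGauss χ (m : ZMod q) =
      ∑ y : (ZMod (redMod q m))ˣ,
        ZMod.stdAddChar (((redArg q m : ℕ) : ZMod (redMod q m)) * (y : ZMod (redMod q m))) *
          ∑ u ∈ (Finset.univ : Finset (ZMod q)ˣ).filter (fun u => ZMod.unitsMap (redMod_dvd q m) u = y),
            χ u := by
  rw [charGauss_eq_sum_units χ hm, ← Finset.sum_fiberwise Finset.univ (ZMod.unitsMap (redMod_dvd q m))]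
  refine Finset.sum_congr rfl fun y _ => ?_
  rw [Finset.mul_sum]
  refine Finset.sum_congr rfl fun u hu => ?_
  rw [(Finset.mem_filter.mp hu).2, mul_comm]

/-- **Case 1 of Lemma 5.4** (Montgomery–Vaughan 1975, p. 359, after Davenport p. 68): if `χ` does not
factor through `q₁` then every fibre sum `S(y) = ∑_{u ↦ y} χ(u)` vanishes: there is a unit
`d ≡ 1 (mod q₁)` with `χ(d) ≠ 1`, and `u ↦ du` permutes the fibre. [cite: MontgomeryVaughanActa1975, §5 Lemma 5.4] -/
theorem sum_fiber_eq_zero_of_not_factorsThrough (χ : DirichletCharacter ℂ q) {d : ℕ} (hd : d ∣ q)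
    (hχ : ¬ χ.FactorsThrough d) (y : (ZMod d)ˣ) :
    ∑ u ∈ (Finset.univ : Finset (ZMod q)ˣ).filter (fun u => ZMod.unitsMap hd u = y), χ u = 0 := by
  rw [DirichletCharacter.factorsThrough_iff_ker_unitsMap hd] at hχ
  obtain ⟨v, hv1, hv2⟩ : ∃ v : (ZMod q)ˣ, ZMod.unitsMap hd v = 1 ∧ χ v ≠ 1 := by
    by_contra hall
    push Not at hall
    exact hχ fun v hv => (MonoidHom.mem_ker.mpr (Units.ext (by
      rw [MulChar.coe_toUnitHom]; exact hall v (MonoidHom.mem_ker.mp hv))))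
  set S := ∑ u ∈ (Finset.univ : Finset (ZMod q)ˣ).filter (fun u => ZMod.unitsMap hd u = y), χ u
  have hS : χ v * S = S := by
    rw [Finset.mul_sum]
    refine Finset.sum_nbij (fun u => v * u) ?_ ?_ ?_ ?_
    · intro u hu
      have hu' := (Finset.mem_filter.mp hu).2
      exact Finset.mem_filter.mpr ⟨Finset.mem_univ _, by rw [map_mul, hv1, one_mul, hu']⟩
    · intro u _ u' _ h
      exact mul_left_cancel h
    · intro u hu
      have hu' : ZMod.unitsMap hd u = y := (Finset.mem_filter.mp (Finset.mem_coe.mp hu)).2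
      refine ⟨v⁻¹ * u, Finset.mem_coe.mpr (Finset.mem_filter.mpr ⟨Finset.mem_univ _, ?_⟩), by group⟩
      rw [map_mul, map_inv, hv1, inv_one, one_mul, hu']
    · intro u _
      push_cast
      rw [map_mul]
  have : (χ v - 1) * S = 0 := by rw [sub_mul, hS, one_mul, sub_self]
  rcases mul_eq_zero.mp this with h | h
  · exact absurd (sub_eq_zero.mp h) hv2
  · exact h

/-- The fibres of `(ℤ/q)ˣ → (ℤ/d)ˣ` all have `φ(q)/φ(d)` elements: precisely
`#{u ↦ y} · φ(d) = φ(q)` (the map is onto, Mathlib's `ZMod.unitsMap_surjective`, and fibres of a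
homomorphism are cosets of the kernel; Montgomery–Vaughan 1975, p. 359, Case 2:
"`S(b) = χ*(b) q₂ ∏_{p ∣ q₂, p ∤ q₁} (1 - 1/p) = χ*(b) φ(q)/φ(q₁)`"). [cite: MontgomeryVaughanActa1975, §5 Lemma 5.4] -/
theorem card_fiber_mul_totient {d : ℕ} [NeZero d] (hd : d ∣ q) (y : (ZMod d)ˣ) :
    ((Finset.univ : Finset (ZMod q)ˣ).filter (fun u => ZMod.unitsMap hd u = y)).card * Nat.totient d =
      Nat.totient q := by
  have hsurj := ZMod.unitsMap_surjective hd (m := q)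
  have hconst : ∀ y' : (ZMod d)ˣ,
      ((Finset.univ : Finset (ZMod q)ˣ).filter (fun u => ZMod.unitsMap hd u = y')).card =
        ((Finset.univ : Finset (ZMod q)ˣ).filter (fun u => ZMod.unitsMap hd u = y)).card :=
    fun y' => MonoidHom.card_fiber_eq_of_mem_range (ZMod.unitsMap hd) (hsurj y') (hsurj y)
  have htot : (Finset.univ : Finset (ZMod q)ˣ).card =
      ∑ y' : (ZMod d)ˣ, ((Finset.univ : Finset (ZMod q)ˣ).filter (fun u => ZMod.unitsMap hd u = y')).card :=
    Finset.card_eq_sum_card_fiberwise (fun u _ => Finset.mem_coe.mpr (Finset.mem_univ _))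
  simp_rw [hconst, Finset.sum_const, smul_eq_mul, Finset.card_univ] at htot
  rw [ZMod.card_units_eq_totient, ZMod.card_units_eq_totient] at htot
  rw [htot, mul_comm]

/-- **Case 2 of Lemma 5.4** (Montgomery–Vaughan 1975, p. 359): if `χ = χ₁χ₀` factors through `d ∣ q`,
the fibre sum is `S(y) = χ₁(y) · φ(q)/φ(d)`. [cite: MontgomeryVaughanActa1975, §5 Lemma 5.4] -/
theorem sum_fiber_changeLevel {d : ℕ} [NeZero d] (hd : d ∣ q) (χ₁ : DirichletCharacter ℂ d)
    (y : (ZMod d)ˣ) :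
    ∑ u ∈ (Finset.univ : Finset (ZMod q)ˣ).filter (fun u => ZMod.unitsMap hd u = y),
        DirichletCharacter.changeLevel hd χ₁ u =
      χ₁ y * ((Nat.totient q / Nat.totient d : ℕ) : ℂ) := by
  have hterm : ∀ u ∈ (Finset.univ : Finset (ZMod q)ˣ).filter (fun u => ZMod.unitsMap hd u = y),
      DirichletCharacter.changeLevel hd χ₁ u = χ₁ y := by
    intro u hu
    rw [← MulChar.coe_toUnitHom, DirichletCharacter.changeLevel_toUnitHom, MonoidHom.comp_apply,
      (Finset.mem_filter.mp hu).2, MulChar.coe_toUnitHom]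
  rw [Finset.sum_congr rfl hterm, Finset.sum_const, nsmul_eq_mul, mul_comm]
  congr 1
  have h := card_fiber_mul_totient hd y (q := q)
  have hφ : 0 < Nat.totient d := Nat.totient_pos.mpr (Nat.pos_of_ne_zero (NeZero.ne d))
  rw [← h, Nat.mul_div_cancel _ hφ]

end Lemma54Main

section Lemma54Final

variable {q : ℕ} [NeZero q]

/-- An induced character `ψχ₀ (mod q)` (`ψ` primitive mod `r`) factors through `d ∣ q` iff `r ∣ d`.
[folklore] -/
theorem factorsThrough_changeLevel_iff {r : ℕ} [NeZero r] (h : r ∣ q) {ψ : DirichletCharacter ℂ r}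
    (hψ : ψ.IsPrimitive) {d : ℕ} (hd : d ∣ q) :
    (DirichletCharacter.changeLevel h ψ).FactorsThrough d ↔ r ∣ d := by
  rw [← DirichletCharacter.mem_conductorSet_iff,
    DirichletCharacter.mem_conductorSet_iff_conductor_dvd _ hd,
    DirichletCharacter.conductor_changeLevel, (DirichletCharacter.isPrimitive_def ψ).mp hψ]

/-- **LEMMA 5.4** (Montgomery–Vaughan 1975, p. 358, (5.1)): let `χ (mod q)` be induced by the
primitive character `χ* (mod r)`, `m ≥ 1`, `q₁ = q/(q, m)`, `m₁ = m/(q, m)`.  If `r ∤ q₁` then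
`c_χ(m) = 0`; if `r ∣ q₁` then
`c_χ(m) = χ̄*(m₁) (φ(q)/φ(q₁)) μ(q₁/r) χ*(q₁/r) τ(χ*)`.
Proof as printed ((5.3): group `h (mod q)` by its residue mod `q₁`; Case 1: the fibre sums vanish;
Case 2: they equal `χ*(b) φ(q)/φ(q₁)`, so `c_χ(m) = (φ(q)/φ(q₁)) c_{χ₁}(m₁)` with `χ₁ = χ*χ₀ (mod q₁)`,
`(m₁, q₁) = 1`; then LEMMA 5.3 `c_{χ₁}(m₁) = χ̄*(m₁) τ(χ₁)` and LEMMA 5.2 for `τ(χ₁)`).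
[cite: MontgomeryVaughanActa1975, §5 Lemma 5.4 (5.1)] -/
theorem charGauss_changeLevel {r : ℕ} [NeZero r] (h : r ∣ q) {ψ : DirichletCharacter ℂ r}
    (hψ : ψ.IsPrimitive) {m : ℕ} (hm : m ≠ 0) :
    charGauss (DirichletCharacter.changeLevel h ψ) (m : ZMod q) =
      if r ∣ redMod q m then
        ψ⁻¹ ((redArg q m : ℕ) : ZMod r) * ((Nat.totient q / Nat.totient (redMod q m) : ℕ) : ℂ) *
          (μ (redMod q m / r) : ℂ) * ψ ((redMod q m / r : ℕ) : ZMod r) * gaussSum ψ ZMod.stdAddChar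
      else 0 := by
  have hq0 : q ≠ 0 := NeZero.ne q
  haveI : NeZero (redMod q m) := ⟨redMod_ne_zero hq0 hm⟩
  rw [charGauss_eq_sum_fibers _ hm]
  by_cases hr : r ∣ redMod q m
  · rw [if_pos hr]
    set χ₁ : DirichletCharacter ℂ (redMod q m) := DirichletCharacter.changeLevel hr ψ with hχ₁
    have hχ : DirichletCharacter.changeLevel h ψ =
        DirichletCharacter.changeLevel (redMod_dvd q m) χ₁ := by
      rw [hχ₁, ← DirichletCharacter.changeLevel_trans]
    simp_rw [hχ, sum_fiber_changeLevel]
    -- `∑_y e(m₁ y) χ₁(y) N = N c_{χ₁}(m₁)`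
    have hsum : ∑ y : (ZMod (redMod q m))ˣ,
        ZMod.stdAddChar (((redArg q m : ℕ) : ZMod (redMod q m)) * (y : ZMod (redMod q m))) *
          (χ₁ y * ((Nat.totient q / Nat.totient (redMod q m) : ℕ) : ℂ)) =
        ((Nat.totient q / Nat.totient (redMod q m) : ℕ) : ℂ) * charGauss χ₁ (redArg q m : ℕ) := by
      rw [charGauss_eq_sum, Finset.mul_sum,
        ← sum_units_eq_sum (fun x => ((Nat.totient q / Nat.totient (redMod q m) : ℕ) : ℂ) *
          (χ₁ x * ZMod.stdAddChar (((redArg q m : ℕ) : ZMod (redMod q m)) * x)))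
          (fun x hx => by rw [MulChar.map_nonunit χ₁ hx, zero_mul, mul_zero])]
      refine Finset.sum_congr rfl fun y _ => ?_
      ring
    rw [hsum]
    -- LEMMA 5.3: `c_{χ₁}(m₁) = χ̄₁(m₁) τ(χ₁)`, `m₁` a unit mod `q₁`
    have hunit : IsUnit ((redArg q m : ℕ) : ZMod (redMod q m)) :=
      (ZMod.isUnit_iff_coprime _ _).mpr (coprime_redArg_redMod hq0)
    have h53 : charGauss χ₁ (redArg q m : ℕ) = χ₁⁻¹ (redArg q m : ℕ) * gaussSum χ₁ ZMod.stdAddChar := by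
      rw [charGauss, ← hunit.unit_spec, gaussSum_mulShift_eq]
    -- LEMMA 5.2 for `τ(χ₁)` and the value `χ̄₁(m₁) = χ̄*(m₁)`
    have h52 : gaussSum χ₁ ZMod.stdAddChar =
        (μ (redMod q m / r) : ℂ) * ψ ((redMod q m / r : ℕ) : ZMod r) * gaussSum ψ ZMod.stdAddChar :=
      gaussSum_changeLevel hr ψ
    have hinv : χ₁⁻¹ ((redArg q m : ℕ) : ZMod (redMod q m)) = ψ⁻¹ ((redArg q m : ℕ) : ZMod r) := by
      rw [hχ₁, ← map_inv, changeLevel_apply_natCast, if_pos (coprime_redArg_redMod hq0)]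
    rw [h53, h52, hinv]
    ring
  · rw [if_neg hr]
    have hnf : ¬ (DirichletCharacter.changeLevel h ψ).FactorsThrough (redMod q m) := by
      rwa [factorsThrough_changeLevel_iff h hψ (redMod_dvd q m)]
    refine Finset.sum_eq_zero fun y _ => ?_
    rw [sum_fiber_eq_zero_of_not_factorsThrough _ (redMod_dvd q m) hnf y, mul_zero]

/-- **LEMMA 5.4, as a bound**: for `χ (mod q)` induced by the primitive `χ* (mod r)` and `m ≥ 1`,
`|c_χ(m)| ≤ [r ∣ q₁] (φ(q)/φ(q₁)) r^{1/2}`, `q₁ = q/(q, m)` (from (5.1) and `|τ(χ*)| = r^{1/2}`,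
LEMMA 5.1). [cite: MontgomeryVaughanActa1975, §5 Lemma 5.4 (5.1)] -/
theorem norm_charGauss_changeLevel_le {r : ℕ} [NeZero r] (h : r ∣ q) {ψ : DirichletCharacter ℂ r}
    (hψ : ψ.IsPrimitive) {m : ℕ} (hm : m ≠ 0) :
    ‖charGauss (DirichletCharacter.changeLevel h ψ) (m : ZMod q)‖ ≤
      (if r ∣ redMod q m then 1 else 0) * ((Nat.totient q / Nat.totient (redMod q m) : ℕ) : ℝ) *
        Real.sqrt r := by
  rw [charGauss_changeLevel h hψ hm]
  split_ifs with hr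
  · have hτ : ‖gaussSum ψ ZMod.stdAddChar‖ = Real.sqrt r := by
      rw [← Real.sqrt_sq (norm_nonneg _), Literature.NumberTheory.Sieve.LargeSieve.norm_gaussSum_sq hψ]
    rw [norm_mul, norm_mul, norm_mul, norm_mul, hτ, one_mul, Complex.norm_natCast]
    have h1 : ‖ψ⁻¹ ((redArg q m : ℕ) : ZMod r)‖ ≤ 1 := DirichletCharacter.norm_le_one _ _
    have h2 : ‖(μ (redMod q m / r) : ℂ)‖ ≤ 1 := by
      rw [Complex.norm_intCast]
      exact_mod_cast ArithmeticFunction.abs_moebius_le_one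
    have h3 : ‖ψ ((redMod q m / r : ℕ) : ZMod r)‖ ≤ 1 := DirichletCharacter.norm_le_one _ _
    have h0 : (0 : ℝ) ≤ ((Nat.totient q / Nat.totient (redMod q m) : ℕ) : ℝ) := by positivity
    calc ‖ψ⁻¹ ((redArg q m : ℕ) : ZMod r)‖ * ((Nat.totient q / Nat.totient (redMod q m) : ℕ) : ℝ) *
          ‖(μ (redMod q m / r) : ℂ)‖ * ‖ψ ((redMod q m / r : ℕ) : ZMod r)‖ * Real.sqrt r
        ≤ 1 * ((Nat.totient q / Nat.totient (redMod q m) : ℕ) : ℝ) * 1 * 1 * Real.sqrt r := by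
          gcongr
      _ = _ := by ring
  · simp

/-- **(5.2)** (Montgomery–Vaughan 1975, p. 358; von Sterneck): the Ramanujan sum
`c_q(m) = c_{χ₀}(m) = μ(q₁) φ(q)/φ(q₁)`, `q₁ = q/(q, m)`, `m ≥ 1` — LEMMA 5.4 with `χ* = 1 (mod 1)`.
[cite: MontgomeryVaughanActa1975, §5 (5.2)] -/
theorem charGauss_one_eq {m : ℕ} (hm : m ≠ 0) :
    charGauss (1 : DirichletCharacter ℂ q) (m : ZMod q) =
      (μ (redMod q m) : ℂ) * ((Nat.totient q / Nat.totient (redMod q m) : ℕ) : ℂ) := by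
  have h1 : (1 : DirichletCharacter ℂ q) = DirichletCharacter.changeLevel (one_dvd q) 1 :=
    (DirichletCharacter.changeLevel_one (one_dvd q)).symm
  rw [h1, charGauss_changeLevel (one_dvd q) DirichletCharacter.isPrimitive_one_level_one hm,
    if_pos (one_dvd _), Nat.div_one, inv_one,
    MulChar.one_apply (R' := ℂ) (isUnit_of_subsingleton ((redArg q m : ℕ) : ZMod 1)),
    MulChar.one_apply (R' := ℂ) (isUnit_of_subsingleton ((redMod q m : ℕ) : ZMod 1))]
  have hτ : gaussSum (1 : DirichletCharacter ℂ 1) ZMod.stdAddChar = 1 := by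
    rw [gaussSum, Fintype.sum_unique, MulChar.one_apply (R' := ℂ) (isUnit_of_subsingleton _),
      one_mul]
    have h0 : ∀ x : ZMod 1, (ZMod.stdAddChar x : ℂ) = 1 := fun x => by
      rw [Subsingleton.elim x 0, AddChar.map_zero_eq_one]
    exact h0 _
  rw [hτ]; ring

end Lemma54Final

/-! ### LEMMA 5.5 — the local (prime-by-prime) inequality for the moduli -/

section Lemma55Local

/-- The local constant `D_p² = max(1, p³/(p-1)⁴)` of the proof of LEMMA 5.5 (it is `1` for `p ≥ 5`,
`8` at `p = 2`, `27/16` at `p = 3`). [cite: MontgomeryVaughanActa1975, §5 Lemma 5.5] -/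
def lemma55Const (p : ℕ) : ℝ := max 1 ((p : ℝ) ^ 3 / ((p : ℝ) - 1) ^ 4)

/-- `D_p² ≥ 1`. [folklore] -/
theorem one_le_lemma55Const (p : ℕ) : 1 ≤ lemma55Const p := le_max_left _ _

/-- `p³ ≤ D_p² (p-1)⁴` for `p ≥ 2`. [folklore] -/
theorem pow_three_le_lemma55Const (p : ℕ) (hp : 2 ≤ p) :
    (p : ℝ) ^ 3 ≤ lemma55Const p * ((p : ℝ) - 1) ^ 4 := by
  have h1 : (1 : ℝ) < p := by exact_mod_cast hp
  have h3 : (p : ℝ) - 1 ≠ 0 := by linarith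
  have h2 : 0 < ((p : ℝ) - 1) ^ 4 := by have : (0:ℝ) < (p : ℝ) - 1 := by linarith
                                        positivity
  calc (p : ℝ) ^ 3 = ((p : ℝ) ^ 3 / ((p : ℝ) - 1) ^ 4) * ((p : ℝ) - 1) ^ 4 := by field_simp
    _ ≤ lemma55Const p * ((p : ℝ) - 1) ^ 4 := by
        gcongr; exact le_max_right _ _

/-- `D_p² = 1` for `p ≥ 5`. [folklore] -/
theorem lemma55Const_eq_one {p : ℕ} (hp : 5 ≤ p) : lemma55Const p = 1 := by
  apply max_eq_left
  have h5 : (5 : ℝ) ≤ p := by exact_mod_cast hp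
  have hpos : 0 < ((p : ℝ) - 1) ^ 4 := by have : (0:ℝ) < (p : ℝ) - 1 := by linarith
                                          positivity
  rw [div_le_one hpos]
  nlinarith [sq_nonneg ((p : ℝ) - 5), sq_nonneg ((p : ℝ) - 1), mul_nonneg (by linarith : (0:ℝ) ≤ (p:ℝ) - 5) (sq_nonneg ((p:ℝ) - 1))]

/-- **The local inequality of LEMMA 5.5** (Montgomery–Vaughan 1975, p. 360–361, the estimation of
`Π₁ Π₂`): with `a_i = v_p(r_i)`, `a₄ = max(a₁, a₂) ≥ 1`, `a₅ = v_p(r₅) ≤ a₄`, `a₃ ≤ a₄ - a₅`,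
`p^{a₁+a₂+a₃} ≤ D_p² · (p/(p-1))^{2[a₅ ≥ 1]} · (p^{a₄-1}(p-1))² · (p^{a₄-a₅-1}(p-1))^{2[a₄ > a₅]}`,
i.e. the `p`-part of `r₁ r₂ r₃` is at most `D_p²` times the `p`-part of
`(∏_{p ∣ r₅} p/(p-1))² φ(r₄)² φ(r₄/r₅)²`. [cite: MontgomeryVaughanActa1975, §5 Lemma 5.5 (5.5)] -/
theorem lemma55_local {p : ℕ} (hp : 2 ≤ p) {a₁ a₂ a₃ a₄ a₅ : ℕ} (h4 : a₄ = max a₁ a₂)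
    (h14 : 1 ≤ a₄) (h5 : a₅ ≤ a₄) (h3 : a₃ ≤ a₄ - a₅) :
    (p : ℝ) ^ (a₁ + a₂ + a₃) ≤
      lemma55Const p * (if 1 ≤ a₅ then ((p : ℝ) / ((p : ℝ) - 1)) ^ 2 else 1) *
        ((p : ℝ) ^ (a₄ - 1) * ((p : ℝ) - 1)) ^ 2 *
        (if 1 ≤ a₄ - a₅ then ((p : ℝ) ^ (a₄ - a₅ - 1) * ((p : ℝ) - 1)) ^ 2 else 1) := by
  have hp1 : (1 : ℝ) ≤ p := by exact_mod_cast (show 1 ≤ p by omega)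
  have hp0 : (0 : ℝ) < p := by linarith
  have hpm1 : (0 : ℝ) < (p : ℝ) - 1 := by
    have : (2 : ℝ) ≤ p := by exact_mod_cast hp
    linarith
  have hD := one_le_lemma55Const p
  rcases Nat.eq_or_lt_of_le h5 with heq | hlt
  · -- `a₅ = a₄`: then `a₃ = 0`
    have ha₅ : 1 ≤ a₅ := by omega
    have hd0 : ¬ (1 ≤ a₄ - a₅) := by omega
    have ha3 : a₃ = 0 := by omega
    rw [if_pos ha₅, if_neg hd0, mul_one, ha3, add_zero]
    have hexp : a₁ + a₂ ≤ 2 * a₄ := by omega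
    have key : ((p : ℝ) / ((p : ℝ) - 1)) ^ 2 * ((p : ℝ) ^ (a₄ - 1) * ((p : ℝ) - 1)) ^ 2 =
        (p : ℝ) ^ (2 * a₄) := by
      have : (p : ℝ) ^ (2 * a₄) = ((p : ℝ) * (p : ℝ) ^ (a₄ - 1)) ^ 2 := by
        rw [← pow_succ', show a₄ - 1 + 1 = a₄ by omega, ← pow_mul, mul_comm]
      rw [this]
      field_simp
    calc (p : ℝ) ^ (a₁ + a₂) ≤ (p : ℝ) ^ (2 * a₄) := pow_le_pow_right₀ hp1 hexp
      _ = 1 * (((p : ℝ) / ((p : ℝ) - 1)) ^ 2 * ((p : ℝ) ^ (a₄ - 1) * ((p : ℝ) - 1)) ^ 2) := by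
          rw [key, one_mul]
      _ ≤ lemma55Const p * (((p : ℝ) / ((p : ℝ) - 1)) ^ 2 *
            ((p : ℝ) ^ (a₄ - 1) * ((p : ℝ) - 1)) ^ 2) := by gcongr
      _ = _ := by ring
  · -- `a₅ < a₄`
    have hd : 1 ≤ a₄ - a₅ := by omega
    rw [if_pos hd]
    set e₁ : ℕ := a₄ - 1 with he₁
    set e₂ : ℕ := a₄ - a₅ - 1 with he₂
    have hexp : a₁ + a₂ + a₃ ≤ 2 * e₁ + 2 * e₂ + 3 := by omega
    have hI : (1 : ℝ) ≤ (if 1 ≤ a₅ then ((p : ℝ) / ((p : ℝ) - 1)) ^ 2 else 1) := by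
      split_ifs
      · have : (1 : ℝ) ≤ (p : ℝ) / ((p : ℝ) - 1) := by
          rw [le_div_iff₀ hpm1]; linarith
        nlinarith
      · exact le_rfl
    calc (p : ℝ) ^ (a₁ + a₂ + a₃) ≤ (p : ℝ) ^ (2 * e₁ + 2 * e₂ + 3) := pow_le_pow_right₀ hp1 hexp
      _ = ((p : ℝ) ^ e₁) ^ 2 * ((p : ℝ) ^ e₂) ^ 2 * (p : ℝ) ^ 3 := by ring
      _ ≤ ((p : ℝ) ^ e₁) ^ 2 * ((p : ℝ) ^ e₂) ^ 2 * (lemma55Const p * ((p : ℝ) - 1) ^ 4) := by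
          gcongr; exact pow_three_le_lemma55Const p hp
      _ = lemma55Const p * 1 * ((p : ℝ) ^ e₁ * ((p : ℝ) - 1)) ^ 2 *
            ((p : ℝ) ^ e₂ * ((p : ℝ) - 1)) ^ 2 := by ring
      _ ≤ lemma55Const p * (if 1 ≤ a₅ then ((p : ℝ) / ((p : ℝ) - 1)) ^ 2 else 1) *
            ((p : ℝ) ^ e₁ * ((p : ℝ) - 1)) ^ 2 * ((p : ℝ) ^ e₂ * ((p : ℝ) - 1)) ^ 2 := by
          gcongr

/-- The product of the local constants over any finite set of primes is at most `16`
(`D_2² D_3² = 8 · 27/16 = 27/2`, `D_p² = 1` for `p ≥ 5`). [folklore] -/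
theorem prod_lemma55Const_le {S : Finset ℕ} (hS : ∀ p ∈ S, p.Prime) :
    ∏ p ∈ S, lemma55Const p ≤ 16 := by
  have hsplit := (Finset.prod_filter_mul_prod_filter_not S (fun p => p < 5) lemma55Const).symm
  rw [hsplit]
  have hbig : ∏ p ∈ S.filter (fun p => ¬ p < 5), lemma55Const p = 1 := by
    refine Finset.prod_eq_one fun p hp => ?_
    exact lemma55Const_eq_one (by have := (Finset.mem_filter.mp hp).2; omega)
  rw [hbig, mul_one]
  have hsub : S.filter (fun p => p < 5) ⊆ ({2, 3} : Finset ℕ) := by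
    intro p hp
    obtain ⟨hpS, hp5⟩ := Finset.mem_filter.mp hp
    have hpp := hS p hpS
    have h2 := hpp.two_le
    interval_cases p
    · simp
    · simp
    · exact absurd hpp (by norm_num)
  calc ∏ p ∈ S.filter (fun p => p < 5), lemma55Const p
      ≤ ∏ p ∈ ({2, 3} : Finset ℕ), lemma55Const p := by
        rw [← Finset.prod_sdiff hsub]
        refine le_mul_of_one_le_left (Finset.prod_nonneg fun p _ =>
          zero_le_one.trans (one_le_lemma55Const p)) ?_
        calc (1 : ℝ) = ∏ p ∈ ({2, 3} : Finset ℕ) \ S.filter (fun p => p < 5), (1 : ℝ) :=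
              Finset.prod_const_one.symm
          _ ≤ _ := Finset.prod_le_prod (fun _ _ => zero_le_one) fun p _ => one_le_lemma55Const p
    _ ≤ 16 := by
        rw [Finset.prod_pair (by norm_num)]
        unfold lemma55Const
        norm_num

end Lemma55Local

section Lemma55Moduli

/-- A positive integer as the product of its prime powers over any finite set of primes containing
its prime factors. [folklore] -/
theorem cast_eq_prod_pow_factorization {n : ℕ} (hn : n ≠ 0) {S : Finset ℕ}
    (hS : n.primeFactors ⊆ S) : (n : ℝ) = ∏ p ∈ S, (p : ℝ) ^ n.factorization p := by
  have h := Nat.prod_factorization_pow_eq_self hn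
  rw [Finsupp.prod, Nat.support_factorization] at h
  conv_lhs => rw [← h]
  push_cast
  refine Finset.prod_subset hS fun p _ hp => ?_
  rw [Finsupp.notMem_support_iff.mp (by rwa [Nat.support_factorization]), pow_zero]

/-- A product over the prime factors as a product over a larger finite set. [folklore] -/
theorem prod_primeFactors_eq_prod_ite {n : ℕ} {S : Finset ℕ} (hS : n.primeFactors ⊆ S)
    (g : ℕ → ℝ) :
    ∏ p ∈ n.primeFactors, g p = ∏ p ∈ S, (if p ∈ n.primeFactors then g p else 1) := by
  rw [Finset.prod_ite, Finset.prod_const_one, mul_one, Finset.filter_mem_eq_inter,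
    Finset.inter_eq_right.mpr hS]

/-- Euler's totient as a product of local factors over any finite set of primes containing the prime
factors: `φ(n) = ∏_{p ∈ S} (p^{v_p(n)-1}(p-1) if p ∣ n, else 1)`. [folklore] -/
theorem totient_cast_eq_prod {n : ℕ} (hn : n ≠ 0) {S : Finset ℕ} (hS : n.primeFactors ⊆ S) :
    (Nat.totient n : ℝ) =
      ∏ p ∈ S, (if p ∈ n.primeFactors then (p : ℝ) ^ (n.factorization p - 1) * ((p : ℝ) - 1)
        else 1) := by
  rw [Nat.totient_eq_prod_factorization hn, Finsupp.prod, Nat.support_factorization]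
  push_cast
  rw [← prod_primeFactors_eq_prod_ite hS]
  refine Finset.prod_congr rfl fun p hp => ?_
  have hp1 : 1 ≤ p := (Nat.prime_of_mem_primeFactors hp).one_lt.le
  rw [Nat.cast_sub hp1, Nat.cast_one]

/-- Membership in the prime factors through the valuation. [folklore] -/
theorem mem_primeFactors_iff_one_le {n p : ℕ} (hn : n ≠ 0) (hp : p.Prime) :
    p ∈ n.primeFactors ↔ 1 ≤ n.factorization p := by
  rw [Nat.mem_primeFactors, ← hp.dvd_iff_one_le_factorization hn]
  exact ⟨fun h => h.2.1, fun h => ⟨hp, h, hn⟩⟩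

/-- **The arithmetic of the moduli in LEMMA 5.5** (Montgomery–Vaughan 1975, pp. 360–361, the bound
`Π₁ Π₂ ≪ ∏_{p ∣ r₅} (1 - 1/p)⁻¹`): for `r₃ ∣ r₄ = [r₁, r₂]`, `r₅ = (r₄, m)` and `r₃ ∣ r₄/r₅`,
`r₁ r₂ r₃ ≤ 16 (∏_{p ∣ r₅} p/(p-1))² φ(r₄)² φ(r₄/r₅)²`, i.e.
`(r₁ r₂ r₃)^{1/2} φ(r₄)⁻¹ φ(r₄/r₅)⁻¹ ≤ 4 ∏_{p ∣ r₅} (1 - 1/p)⁻¹` (prime by prime, `lemma55_local`).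
[cite: MontgomeryVaughanActa1975, §5 Lemma 5.5 (5.5)] -/
theorem lemma55_moduli {r₁ r₂ r₃ m : ℕ} (h₁ : r₁ ≠ 0) (h₂ : r₂ ≠ 0) (hm : m ≠ 0)
    (h₃ : r₃ ∣ Nat.lcm r₁ r₂)
    (h₃' : r₃ ∣ Nat.lcm r₁ r₂ / Nat.gcd (Nat.lcm r₁ r₂) m) :
    ((r₁ * r₂ * r₃ : ℕ) : ℝ) ≤
      16 * (∏ p ∈ (Nat.gcd (Nat.lcm r₁ r₂) m).primeFactors, ((p : ℝ) / ((p : ℝ) - 1))) ^ 2 *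
        (Nat.totient (Nat.lcm r₁ r₂) : ℝ) ^ 2 *
        (Nat.totient (Nat.lcm r₁ r₂ / Nat.gcd (Nat.lcm r₁ r₂) m) : ℝ) ^ 2 := by
  set r₄ := Nat.lcm r₁ r₂ with hr₄
  set r₅ := Nat.gcd r₄ m with hr₅
  set r₆ := r₄ / r₅ with hr₆
  have h₄ : r₄ ≠ 0 := Nat.lcm_ne_zero h₁ h₂
  have h₅ : r₅ ≠ 0 := Nat.gcd_ne_zero_right hm
  have h₅₄ : r₅ ∣ r₄ := Nat.gcd_dvd_left r₄ m
  have h₆ : r₆ ≠ 0 := (Nat.div_ne_zero_iff_of_dvd h₅₄).mpr ⟨h₄, h₅⟩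
  have h₃0 : r₃ ≠ 0 := ne_zero_of_dvd_ne_zero h₄ h₃
  have h₁₄ : r₁ ∣ r₄ := Nat.dvd_lcm_left r₁ r₂
  have h₂₄ : r₂ ∣ r₄ := Nat.dvd_lcm_right r₁ r₂
  have h₆₄ : r₆ ∣ r₄ := Nat.div_dvd_of_dvd h₅₄
  set S := r₄.primeFactors with hS
  have hSp : ∀ p ∈ S, p.Prime := fun p hp => Nat.prime_of_mem_primeFactors hp
  have sub : ∀ {n : ℕ}, n ∣ r₄ → n.primeFactors ⊆ S := fun h => Nat.primeFactors_mono h h₄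
  -- valuations
  set a : ℕ → ℕ → ℕ := fun n p => n.factorization p with ha
  have hv₄ : ∀ p, a r₄ p = max (a r₁ p) (a r₂ p) := fun p => by
    show r₄.factorization p = max (r₁.factorization p) (r₂.factorization p)
    rw [hr₄, Nat.factorization_lcm h₁ h₂, Finsupp.sup_apply]
  have hv₆ : ∀ p, a r₆ p = a r₄ p - a r₅ p := fun p => by
    show r₆.factorization p = r₄.factorization p - r₅.factorization p
    rw [hr₆, Nat.factorization_div h₅₄, Finsupp.tsub_apply]
  have hv₅le : ∀ p, a r₅ p ≤ a r₄ p := fun p => (Nat.factorization_le_iff_dvd h₅ h₄).mpr h₅₄ p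
  have hv₃le : ∀ p, a r₃ p ≤ a r₆ p := fun p => (Nat.factorization_le_iff_dvd h₃0 h₆).mpr h₃' p
  -- both sides as products over `S`
  have hL : ((r₁ * r₂ * r₃ : ℕ) : ℝ) = ∏ p ∈ S, (p : ℝ) ^ (a r₁ p + a r₂ p + a r₃ p) := by
    push_cast
    rw [cast_eq_prod_pow_factorization h₁ (sub h₁₄), cast_eq_prod_pow_factorization h₂ (sub h₂₄),
      cast_eq_prod_pow_factorization h₃0 (sub h₃), ← Finset.prod_mul_distrib,
      ← Finset.prod_mul_distrib]
    refine Finset.prod_congr rfl fun p _ => ?_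
    rw [pow_add, pow_add]
  have hR₅ : ∏ p ∈ r₅.primeFactors, ((p : ℝ) / ((p : ℝ) - 1)) =
      ∏ p ∈ S, (if 1 ≤ a r₅ p then (p : ℝ) / ((p : ℝ) - 1) else 1) := by
    rw [prod_primeFactors_eq_prod_ite (sub h₅₄)]
    refine Finset.prod_congr rfl fun p hp => ?_
    simp only [mem_primeFactors_iff_one_le h₅ (hSp p hp)]
    rfl
  have hR₄ : (Nat.totient r₄ : ℝ) = ∏ p ∈ S, ((p : ℝ) ^ (a r₄ p - 1) * ((p : ℝ) - 1)) := by
    rw [totient_cast_eq_prod h₄ (subset_refl _)]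
    refine Finset.prod_congr rfl fun p hp => ?_
    rw [if_pos hp]
  have hR₆ : (Nat.totient r₆ : ℝ) = ∏ p ∈ S, (if 1 ≤ a r₄ p - a r₅ p then
      (p : ℝ) ^ (a r₄ p - a r₅ p - 1) * ((p : ℝ) - 1) else 1) := by
    rw [totient_cast_eq_prod h₆ (sub h₆₄)]
    refine Finset.prod_congr rfl fun p hp => ?_
    simp only [mem_primeFactors_iff_one_le h₆ (hSp p hp), show r₆.factorization p = a r₄ p - a r₅ p
      from hv₆ p]
  have hRHS : 16 * (∏ p ∈ S, (if 1 ≤ a r₅ p then (p : ℝ) / ((p : ℝ) - 1) else 1)) ^ 2 *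
      (∏ p ∈ S, ((p : ℝ) ^ (a r₄ p - 1) * ((p : ℝ) - 1))) ^ 2 *
      (∏ p ∈ S, (if 1 ≤ a r₄ p - a r₅ p then
        (p : ℝ) ^ (a r₄ p - a r₅ p - 1) * ((p : ℝ) - 1) else 1)) ^ 2 =
      16 * ∏ p ∈ S, ((if 1 ≤ a r₅ p then (p : ℝ) / ((p : ℝ) - 1) else 1) ^ 2 *
          ((p : ℝ) ^ (a r₄ p - 1) * ((p : ℝ) - 1)) ^ 2 *
          (if 1 ≤ a r₄ p - a r₅ p then (p : ℝ) ^ (a r₄ p - a r₅ p - 1) * ((p : ℝ) - 1) else 1) ^ 2) := by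
    rw [← Finset.prod_pow, ← Finset.prod_pow, ← Finset.prod_pow, Finset.prod_mul_distrib,
      Finset.prod_mul_distrib]
    ring
  rw [hL, hR₅, hR₄, hR₆, hRHS]
  -- prime by prime
  have hnonneg : ∀ p ∈ S, (0 : ℝ) ≤ (if 1 ≤ a r₅ p then (p : ℝ) / ((p : ℝ) - 1) else 1) ^ 2 *
      ((p : ℝ) ^ (a r₄ p - 1) * ((p : ℝ) - 1)) ^ 2 *
      (if 1 ≤ a r₄ p - a r₅ p then (p : ℝ) ^ (a r₄ p - a r₅ p - 1) * ((p : ℝ) - 1) else 1) ^ 2 :=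
    fun p _ => by positivity
  calc ∏ p ∈ S, (p : ℝ) ^ (a r₁ p + a r₂ p + a r₃ p)
      ≤ ∏ p ∈ S, (lemma55Const p * ((if 1 ≤ a r₅ p then (p : ℝ) / ((p : ℝ) - 1) else 1) ^ 2 *
          ((p : ℝ) ^ (a r₄ p - 1) * ((p : ℝ) - 1)) ^ 2 *
          (if 1 ≤ a r₄ p - a r₅ p then (p : ℝ) ^ (a r₄ p - a r₅ p - 1) * ((p : ℝ) - 1) else 1) ^ 2)) := by
        refine Finset.prod_le_prod (fun p _ => by positivity) fun p hp => ?_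
        have hp2 : 2 ≤ p := (hSp p hp).two_le
        have h14 : 1 ≤ a r₄ p := (mem_primeFactors_iff_one_le h₄ (hSp p hp)).mp hp
        have key := lemma55_local hp2 (hv₄ p) h14 (hv₅le p) ((hv₃le p).trans (hv₆ p).le)
        have e1 : (if 1 ≤ a r₅ p then ((p : ℝ) / ((p : ℝ) - 1)) ^ 2 else 1) =
            (if 1 ≤ a r₅ p then (p : ℝ) / ((p : ℝ) - 1) else 1) ^ 2 := by
          split_ifs <;> simp
        have e2 : (if 1 ≤ a r₄ p - a r₅ p then ((p : ℝ) ^ (a r₄ p - a r₅ p - 1) * ((p : ℝ) - 1)) ^ 2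
            else 1) = (if 1 ≤ a r₄ p - a r₅ p then (p : ℝ) ^ (a r₄ p - a r₅ p - 1) * ((p : ℝ) - 1)
            else 1) ^ 2 := by
          split_ifs <;> simp
        rw [e1, e2] at key
        linarith [key]
    _ = (∏ p ∈ S, lemma55Const p) * ∏ p ∈ S, ((if 1 ≤ a r₅ p then (p : ℝ) / ((p : ℝ) - 1) else 1) ^ 2 *
          ((p : ℝ) ^ (a r₄ p - 1) * ((p : ℝ) - 1)) ^ 2 *
          (if 1 ≤ a r₄ p - a r₅ p then (p : ℝ) ^ (a r₄ p - a r₅ p - 1) * ((p : ℝ) - 1) else 1) ^ 2) := by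
        rw [← Finset.prod_mul_distrib]
    _ ≤ 16 * ∏ p ∈ S, ((if 1 ≤ a r₅ p then (p : ℝ) / ((p : ℝ) - 1) else 1) ^ 2 *
          ((p : ℝ) ^ (a r₄ p - 1) * ((p : ℝ) - 1)) ^ 2 *
          (if 1 ≤ a r₄ p - a r₅ p then (p : ℝ) ^ (a r₄ p - a r₅ p - 1) * ((p : ℝ) - 1) else 1) ^ 2) := by
        gcongr
        exact prod_lemma55Const_le hSp

end Lemma55Moduli

/-! ### LEMMA 5.5 — the sum over the cofactor `k` -/

section Lemma55KSum

/-- The multiplicative weight `F(k) = [k squarefree, (k, R) = 1] / (φ(k) φ(k/(k, m)))` of the proof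
of LEMMA 5.5 (Montgomery–Vaughan 1975, (5.5): `∑_{(k, r₄) = 1} μ(k)² φ(k)⁻¹ φ(k/(k,m))⁻¹`), as a real
arithmetic function of `k`. [cite: MontgomeryVaughanActa1975, §5 Lemma 5.5 (5.5)] -/
def lemma55Weight (R m : ℕ) : ArithmeticFunction ℝ :=
  ⟨fun k => if Squarefree k ∧ k.Coprime R then
      1 / ((Nat.totient k : ℝ) * (Nat.totient (k / Nat.gcd k m) : ℝ)) else 0,
    by simp [not_squarefree_zero]⟩

/-- Unfolding lemma for `lemma55Weight`. [folklore] -/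
theorem lemma55Weight_apply (R m k : ℕ) :
    lemma55Weight R m k = if Squarefree k ∧ k.Coprime R then
      1 / ((Nat.totient k : ℝ) * (Nat.totient (k / Nat.gcd k m) : ℝ)) else 0 := rfl

/-- `F ≥ 0`. [folklore] -/
theorem lemma55Weight_nonneg (R m k : ℕ) : 0 ≤ lemma55Weight R m k := by
  rw [lemma55Weight_apply]; split_ifs <;> positivity

/-- `F` vanishes off the squarefree integers. [folklore] -/
theorem lemma55Weight_eq_zero_of_not_squarefree (R m : ℕ) {k : ℕ} (hk : ¬ Squarefree k) :
    lemma55Weight R m k = 0 := by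
  rw [lemma55Weight_apply, if_neg (fun h => hk h.1)]

/-- `k ↦ k/(k, m)` is multiplicative: for coprime `a, b`,
`ab/(ab, m) = (a/(a,m)) (b/(b,m))` with coprime factors. [folklore] -/
theorem div_gcd_mul {a b : ℕ} (hab : a.Coprime b) (m : ℕ) :
    a * b / Nat.gcd (a * b) m = (a / Nat.gcd a m) * (b / Nat.gcd b m) := by
  rw [Nat.gcd_comm (a * b) m, Nat.Coprime.gcd_mul m hab, Nat.gcd_comm m a, Nat.gcd_comm m b,
    Nat.div_mul_div_comm (Nat.gcd_dvd_left a m) (Nat.gcd_dvd_left b m)]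

/-- `F` is multiplicative. [folklore] -/
theorem isMultiplicative_lemma55Weight (R m : ℕ) : (lemma55Weight R m).IsMultiplicative := by
  refine ⟨?_, fun {a b} hab => ?_⟩
  · rw [lemma55Weight_apply, if_pos ⟨squarefree_one, Nat.coprime_one_left R⟩]
    simp
  · rw [lemma55Weight_apply, lemma55Weight_apply, lemma55Weight_apply]
    by_cases ha : Squarefree a ∧ a.Coprime R
    · by_cases hb : Squarefree b ∧ b.Coprime R
      · have habsq : Squarefree (a * b) := Nat.squarefree_mul_iff.mpr ⟨hab, ha.1, hb.1⟩
        have habR : (a * b).Coprime R := Nat.coprime_mul_iff_left.mpr ⟨ha.2, hb.2⟩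
        rw [if_pos ⟨habsq, habR⟩, if_pos ha, if_pos hb, div_gcd_mul hab m, Nat.totient_mul hab,
          Nat.totient_mul (Nat.Coprime.coprime_dvd_left (Nat.div_dvd_of_dvd (Nat.gcd_dvd_left a m))
            (Nat.Coprime.coprime_dvd_right (Nat.div_dvd_of_dvd (Nat.gcd_dvd_left b m)) hab))]
        push_cast
        have h1 : (Nat.totient a : ℝ) ≠ 0 := by
          exact_mod_cast (Nat.totient_pos.mpr (Nat.pos_of_ne_zero ha.1.ne_zero)).ne'
        have h2 : (Nat.totient b : ℝ) ≠ 0 := by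
          exact_mod_cast (Nat.totient_pos.mpr (Nat.pos_of_ne_zero hb.1.ne_zero)).ne'
        have h3 : (Nat.totient (a / Nat.gcd a m) : ℝ) ≠ 0 := by
          have : a / Nat.gcd a m ≠ 0 := (Nat.div_ne_zero_iff_of_dvd (Nat.gcd_dvd_left a m)).mpr
            ⟨ha.1.ne_zero, Nat.gcd_ne_zero_left ha.1.ne_zero⟩
          exact_mod_cast (Nat.totient_pos.mpr (Nat.pos_of_ne_zero this)).ne'
        have h4 : (Nat.totient (b / Nat.gcd b m) : ℝ) ≠ 0 := by
          have : b / Nat.gcd b m ≠ 0 := (Nat.div_ne_zero_iff_of_dvd (Nat.gcd_dvd_left b m)).mpr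
            ⟨hb.1.ne_zero, Nat.gcd_ne_zero_left hb.1.ne_zero⟩
          exact_mod_cast (Nat.totient_pos.mpr (Nat.pos_of_ne_zero this)).ne'
        field_simp
      · have : ¬ (Squarefree (a * b) ∧ (a * b).Coprime R) := fun h =>
          hb ⟨(Nat.squarefree_mul_iff.mp h.1).2.2, Nat.Coprime.coprime_dvd_left (dvd_mul_left b a) h.2⟩
        rw [if_neg this, if_neg hb, mul_zero]
    · have : ¬ (Squarefree (a * b) ∧ (a * b).Coprime R) := fun h =>
        ha ⟨(Nat.squarefree_mul_iff.mp h.1).2.1, Nat.Coprime.coprime_dvd_left (dvd_mul_right a b) h.2⟩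
      rw [if_neg this, if_neg ha, zero_mul]

/-- The local factors: `1 + F(p) ≤ (1 + [p ∣ m, p ∤ R]/(p-1)) (1 + 1/(p-1)²)` for a prime `p`
(`F(p) = 1/(p-1)` if `p ∣ m`, `1/(p-1)²` if `p ∤ m`, `0` if `p ∣ R`). [cite: MontgomeryVaughanActa1975, §5 Lemma 5.5] -/
theorem one_add_lemma55Weight_prime_le (R m : ℕ) {p : ℕ} (hp : p.Prime) :
    1 + lemma55Weight R m p ≤
      (if p ∣ m ∧ ¬ p ∣ R then (p : ℝ) / ((p : ℝ) - 1) else 1) * (1 + 1 / ((p : ℝ) - 1) ^ 2) := by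
  have hp2 : (2 : ℝ) ≤ p := by exact_mod_cast hp.two_le
  have hp1 : (0 : ℝ) < (p : ℝ) - 1 := by linarith
  have hφp : (Nat.totient p : ℝ) = (p : ℝ) - 1 := by
    rw [Nat.totient_prime hp, Nat.cast_sub hp.one_lt.le, Nat.cast_one]
  have hA : (1 : ℝ) ≤ 1 + 1 / ((p : ℝ) - 1) ^ 2 := by
    have : (0 : ℝ) ≤ 1 / ((p : ℝ) - 1) ^ 2 := by positivity
    linarith
  rw [lemma55Weight_apply]
  by_cases hR : p ∣ R
  · have : ¬ (Squarefree p ∧ p.Coprime R) := fun h =>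
      ((Nat.Prime.coprime_iff_not_dvd hp).mp h.2) hR
    rw [if_neg this, add_zero, if_neg (fun h => h.2 hR), one_mul]
    exact hA
  · have hcop : p.Coprime R := (Nat.Prime.coprime_iff_not_dvd hp).mpr hR
    rw [if_pos ⟨hp.squarefree, hcop⟩]
    by_cases hm : p ∣ m
    · rw [if_pos ⟨hm, hR⟩, Nat.gcd_eq_left hm, Nat.div_self hp.pos, Nat.totient_one, Nat.cast_one,
        mul_one, hφp]
      have : 1 + 1 / ((p : ℝ) - 1) = (p : ℝ) / ((p : ℝ) - 1) := by field_simp; ring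
      rw [this]
      exact le_mul_of_one_le_right (by positivity) hA
    · have hg : Nat.gcd p m = 1 := ((Nat.Prime.coprime_iff_not_dvd hp).mpr hm).gcd_eq_one
      rw [if_neg (fun h => hm h.1), one_mul, hg, Nat.div_one, hφp, sq, one_div]

end Lemma55KSum

section Lemma55KSum2

/-- `∑_{2 ≤ n ≤ M+1} 1/(n-1)² ≤ 2 - 1/M` (`M ≥ 1`; telescoping `1/j² ≤ 1/(j-1) - 1/j`). [folklore] -/
theorem sum_Ico_inv_sq_le (M : ℕ) (hM : 1 ≤ M) :
    ∑ n ∈ Finset.Ico 2 (M + 2), 1 / ((n : ℝ) - 1) ^ 2 ≤ 2 - 1 / (M : ℝ) := by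
  induction M with
  | zero => omega
  | succ M ih =>
    rcases Nat.eq_zero_or_pos M with hM0 | hMpos
    · subst hM0
      rw [show (0 + 1 + 2 : ℕ) = 2 + 1 by rfl, Finset.sum_Ico_succ_top (by norm_num),
        Finset.Ico_self, Finset.sum_empty]
      norm_num
    · have ih' := ih hMpos
      rw [show M + 1 + 2 = (M + 2) + 1 by ring, Finset.sum_Ico_succ_top (by omega)]
      have hM' : (0 : ℝ) < M := by exact_mod_cast hMpos
      have hterm : 1 / (((M + 2 : ℕ) : ℝ) - 1) ^ 2 = 1 / ((M : ℝ) + 1) ^ 2 := by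
        push_cast; ring
      rw [hterm]
      have hstep : 1 / ((M : ℝ) + 1) ^ 2 ≤ 1 / (M : ℝ) - 1 / ((M : ℝ) + 1) := by
        rw [div_sub_div _ _ hM'.ne' (by positivity), div_le_div_iff₀ (by positivity) (by positivity)]
        nlinarith
      push_cast
      linarith

/-- `∑_{p < N prime} 1/(p-1)² ≤ 2`. [folklore] -/
theorem sum_primesBelow_inv_sq_le (N : ℕ) :
    ∑ p ∈ N.primesBelow, 1 / ((p : ℝ) - 1) ^ 2 ≤ 2 := by
  have hsub : N.primesBelow ⊆ Finset.Ico 2 (N + 2) := by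
    intro p hp
    have hp' := Nat.mem_primesBelow.mp hp
    exact Finset.mem_Ico.mpr ⟨hp'.2.two_le, by omega⟩
  calc ∑ p ∈ N.primesBelow, 1 / ((p : ℝ) - 1) ^ 2
      ≤ ∑ n ∈ Finset.Ico 2 (N + 2), 1 / ((n : ℝ) - 1) ^ 2 :=
        Finset.sum_le_sum_of_subset_of_nonneg hsub fun n _ _ => by positivity
    _ ≤ 2 - 1 / (N : ℝ) := by
        rcases Nat.eq_zero_or_pos N with h0 | hpos
        · subst h0; simp
        · exact sum_Ico_inv_sq_le N hpos
    _ ≤ 2 := by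
        have : (0 : ℝ) ≤ 1 / (N : ℝ) := by positivity
        linarith

/-- `∏_{p < N} (1 + 1/(p-1)²) ≤ e²`. [folklore] -/
theorem prod_primesBelow_one_add_inv_sq_le (N : ℕ) :
    ∏ p ∈ N.primesBelow, (1 + 1 / ((p : ℝ) - 1) ^ 2) ≤ Real.exp 2 := by
  calc ∏ p ∈ N.primesBelow, (1 + 1 / ((p : ℝ) - 1) ^ 2)
      ≤ ∏ p ∈ N.primesBelow, Real.exp (1 / ((p : ℝ) - 1) ^ 2) := by
        refine Finset.prod_le_prod (fun p _ => by positivity) fun p _ => ?_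
        have := Real.add_one_le_exp (1 / ((p : ℝ) - 1) ^ 2)
        linarith
    _ = Real.exp (∑ p ∈ N.primesBelow, 1 / ((p : ℝ) - 1) ^ 2) := (Real.exp_sum _ _).symm
    _ ≤ Real.exp 2 := Real.exp_le_exp.mpr (sum_primesBelow_inv_sq_le N)

/-- A product of factors `≥ 1` over a subset is at most the product over the set. [folklore] -/
theorem prod_le_prod_of_subset_of_one_le_real {ι : Type*} {s t : Finset ι} (h : s ⊆ t)
    {f : ι → ℝ} (hf : ∀ i ∈ t, 1 ≤ f i) : ∏ i ∈ s, f i ≤ ∏ i ∈ t, f i := by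
  classical
  rw [← Finset.prod_sdiff h]
  refine le_mul_of_one_le_left (Finset.prod_nonneg fun i hi => zero_le_one.trans (hf i (h hi))) ?_
  calc (1 : ℝ) = ∏ i ∈ t \ s, (1 : ℝ) := Finset.prod_const_one.symm
    _ ≤ _ := Finset.prod_le_prod (fun _ _ => zero_le_one) fun i hi =>
        hf i (Finset.mem_sdiff.mp hi).1

/-- **The `k`-sum of LEMMA 5.5** (Montgomery–Vaughan 1975, p. 360:
`∑_{(k,r₄)=1} μ(k)² φ(k)⁻¹ φ(k/(k,m))⁻¹ = ∏_{p∤r₄, p∤m}(1 + (p-1)⁻²) ∏_{p∤r₄, p∣m}(1 + (p-1)⁻¹) ≪ ∏_{p∤r₄, p∣m}(1 - 1/p)⁻¹`):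
for `m ≥ 1` and every `N`,
`∑_{k < N} F(k) ≤ e² ∏_{p ∣ m, p ∤ R} p/(p-1)`. [cite: MontgomeryVaughanActa1975, §5 Lemma 5.5 (5.5)] -/
theorem sum_lemma55Weight_le (R : ℕ) {m : ℕ} (hm : m ≠ 0) (N : ℕ) :
    ∑ k ∈ Finset.range N, lemma55Weight R m k ≤
      Real.exp 2 * ∏ p ∈ m.primeFactors.filter (fun p => ¬ p ∣ R), ((p : ℝ) / ((p : ℝ) - 1)) := by
  have h1 := Literature.NumberTheory.Sieve.GoldbachSeries.sum_range_le_prod_primesBelow (isMultiplicative_lemma55Weight R m)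
    (lemma55Weight_nonneg R m) (fun k hk => lemma55Weight_eq_zero_of_not_squarefree R m hk) N
  refine h1.trans ?_
  have hfac : ∀ p ∈ N.primesBelow, (1 : ℝ) ≤ (if p ∣ m ∧ ¬ p ∣ R then (p : ℝ) / ((p : ℝ) - 1) else 1) := by
    intro p hp
    split_ifs
    · have hp2 : (2 : ℝ) ≤ p := by exact_mod_cast (Nat.mem_primesBelow.mp hp).2.two_le
      rw [le_div_iff₀ (by linarith)]; linarith
    · exact le_rfl
  calc ∏ p ∈ N.primesBelow, (1 + lemma55Weight R m p)
      ≤ ∏ p ∈ N.primesBelow, ((if p ∣ m ∧ ¬ p ∣ R then (p : ℝ) / ((p : ℝ) - 1) else 1) *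
          (1 + 1 / ((p : ℝ) - 1) ^ 2)) :=
        Finset.prod_le_prod (fun p _ => by linarith [lemma55Weight_nonneg R m p])
          fun p hp => one_add_lemma55Weight_prime_le R m (Nat.mem_primesBelow.mp hp).2
    _ = (∏ p ∈ N.primesBelow, (if p ∣ m ∧ ¬ p ∣ R then (p : ℝ) / ((p : ℝ) - 1) else 1)) *
          ∏ p ∈ N.primesBelow, (1 + 1 / ((p : ℝ) - 1) ^ 2) := Finset.prod_mul_distrib
    _ ≤ (∏ p ∈ m.primeFactors.filter (fun p => ¬ p ∣ R), ((p : ℝ) / ((p : ℝ) - 1))) *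
          Real.exp 2 := by
        gcongr
        · exact Finset.prod_nonneg fun p hp => by
            have hp2 : (2 : ℝ) ≤ p := by
              exact_mod_cast (Nat.prime_of_mem_primeFactors (Finset.mem_filter.mp hp).1).two_le
            have : (0 : ℝ) < (p : ℝ) - 1 := by linarith
            positivity
        · -- the first product, over `p < N` prime with `p ∣ m`, `p ∤ R`
          rw [Finset.prod_ite, Finset.prod_const_one, mul_one]
          refine prod_le_prod_of_subset_of_one_le_real ?_ ?_
          · intro p hp
            obtain ⟨hp1, hp2⟩ := Finset.mem_filter.mp hp
            exact Finset.mem_filter.mpr ⟨Nat.mem_primeFactors.mpr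
              ⟨(Nat.mem_primesBelow.mp hp1).2, hp2.1, hm⟩, hp2.2⟩
          · intro p hp
            have hp2 : (2 : ℝ) ≤ p := by
              exact_mod_cast (Nat.prime_of_mem_primeFactors (Finset.mem_filter.mp hp).1).two_le
            rw [le_div_iff₀ (by linarith)]; linarith
        · exact prod_primesBelow_one_add_inv_sq_le N
    _ = _ := mul_comm _ _

end Lemma55KSum2

/-! ### LEMMA 5.5 assembled -/

section Lemma55

/-- The summand of LEMMA 5.5 at the modulus `q` (Montgomery–Vaughan 1975, (5.4)): for primitive
`χ₁ (mod r₁)`, `χ₂ (mod r₂)` and `q` divisible by `r₁` and `r₂`,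
`φ(q)⁻² |c_{χ₁χ₂χ₀}(m)| |τ(χ̄₁χ₀)| |τ(χ̄₂χ₀)|` (`χ₀` principal mod `q`); `0` for other `q`.
[cite: MontgomeryVaughanActa1975, §5 Lemma 5.5 (5.4)] -/
def lemma55Term {r₁ r₂ : ℕ} (ψ₁ : DirichletCharacter ℂ r₁) (ψ₂ : DirichletCharacter ℂ r₂)
    (m q : ℕ) : ℝ :=
  if h : r₁ ∣ q ∧ r₂ ∣ q ∧ q ≠ 0 then
    haveI : NeZero q := ⟨h.2.2⟩
    ‖charGauss (DirichletCharacter.changeLevel h.1 ψ₁ * DirichletCharacter.changeLevel h.2.1 ψ₂)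
        (m : ZMod q)‖ *
      ‖gaussSum (DirichletCharacter.changeLevel h.1 ψ₁)⁻¹ ZMod.stdAddChar‖ *
      ‖gaussSum (DirichletCharacter.changeLevel h.2.1 ψ₂)⁻¹ ZMod.stdAddChar‖ / (Nat.totient q : ℝ) ^ 2
  else 0

/-- `φ(q₁) ∣ φ(q)` for `q₁ = q/(q, m)`. [folklore] -/
theorem totient_redMod_dvd {q : ℕ} [NeZero q] {m : ℕ} (hm : m ≠ 0) :
    Nat.totient (redMod q m) ∣ Nat.totient q := by
  haveI : NeZero (redMod q m) := ⟨redMod_ne_zero (NeZero.ne q) hm⟩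
  exact Dvd.intro_left _ (card_fiber_mul_totient (redMod_dvd q m) (1 : (ZMod (redMod q m))ˣ) (q := q))

/-- `q₁` is multiplicative in `q`: `(ak)/(ak, m) = (a/(a,m)) (k/(k,m))` for coprime `a, k`, with
coprime factors. [folklore] -/
theorem redMod_mul {a k : ℕ} (h : a.Coprime k) (m : ℕ) :
    redMod (a * k) m = redMod a m * redMod k m ∧ (redMod a m).Coprime (redMod k m) := by
  refine ⟨div_gcd_mul h m, ?_⟩
  exact Nat.Coprime.coprime_dvd_left (Nat.div_dvd_of_dvd (Nat.gcd_dvd_left a m))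
    (Nat.Coprime.coprime_dvd_right (Nat.div_dvd_of_dvd (Nat.gcd_dvd_left k m)) h)

/-- The Gauss sum of the conjugate of an induced character: for `ψ` primitive mod `r`, `r ∣ q`,
`|τ(ψ̄χ₀)| ≤ r^{1/2} · [q/r squarefree and coprime to r]` (LEMMAS 5.1–5.2). [cite: MontgomeryVaughanActa1975, §5 Lemma 5.2] -/
theorem norm_gaussSum_changeLevel_inv_le {r q : ℕ} [NeZero q] [NeZero r] (h : r ∣ q)
    {ψ : DirichletCharacter ℂ r} (hψ : ψ.IsPrimitive) :
    ‖gaussSum (DirichletCharacter.changeLevel h ψ)⁻¹ ZMod.stdAddChar‖ ≤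
      Real.sqrt r * (if Squarefree (q / r) ∧ (q / r).Coprime r then 1 else 0) := by
  have hψ' : ψ⁻¹.IsPrimitive := by
    rw [DirichletCharacter.isPrimitive_def, DirichletCharacter.conductor_inv]; exact hψ
  rw [← map_inv]
  have hsq := norm_gaussSum_changeLevel_sq h hψ'
  split_ifs with hc
  · rw [mul_one]
    have : ‖gaussSum (DirichletCharacter.changeLevel h ψ⁻¹) ZMod.stdAddChar‖ ^ 2 ≤ r := by
      rw [hsq]
      have h1 : (μ (q / r) : ℝ) ^ 2 ≤ 1 := by
        have := ArithmeticFunction.abs_moebius_le_one (n := q / r)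
        have h' : |(μ (q / r) : ℝ)| ≤ 1 := by exact_mod_cast this
        nlinarith [abs_nonneg (μ (q / r) : ℝ), sq_abs (μ (q / r) : ℝ)]
      have h2 : ‖ψ⁻¹ ((q / r : ℕ) : ZMod r)‖ ^ 2 ≤ 1 := by
        have := DirichletCharacter.norm_le_one ψ⁻¹ ((q / r : ℕ) : ZMod r)
        nlinarith [norm_nonneg (ψ⁻¹ ((q / r : ℕ) : ZMod r))]
      have hr : (0 : ℝ) ≤ r := by positivity
      calc (μ (q / r) : ℝ) ^ 2 * ‖ψ⁻¹ ((q / r : ℕ) : ZMod r)‖ ^ 2 * r ≤ 1 * 1 * r := by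
            gcongr
        _ = r := by ring
    exact (Real.le_sqrt (norm_nonneg _) (by positivity)).mpr this
  · rw [mul_zero]
    have : ‖gaussSum (DirichletCharacter.changeLevel h ψ⁻¹) ZMod.stdAddChar‖ ^ 2 = 0 := by
      rw [hsq]
      rw [not_and_or] at hc
      rcases hc with hc | hc
      · rw [ArithmeticFunction.moebius_eq_zero_of_not_squarefree hc]; simp
      · rw [MulChar.map_nonunit _ (mt (ZMod.isUnit_iff_coprime _ _).mp hc)]; simp
    have := pow_eq_zero_iff (n := 2) (by norm_num) |>.mp this
    rw [this]

/-- From `q/r_i` squarefree and coprime to `r_i` (`i = 1, 2`) for `q = r₄ k`, `r₄ = [r₁, r₂]`: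
`k` is squarefree and coprime to `r₄` (Montgomery–Vaughan 1975, p. 360: "we deduce that
`(k, r₄) = 1` and `μ(k)² = 1`"). [cite: MontgomeryVaughanActa1975, §5 Lemma 5.5] -/
theorem squarefree_coprime_cofactor {r₁ r₂ q : ℕ} (h₁ : r₁ ∣ q) (h₂ : r₂ ∣ q)
    (hc₁ : Squarefree (q / r₁) ∧ (q / r₁).Coprime r₁) (hc₂ : Squarefree (q / r₂) ∧ (q / r₂).Coprime r₂) :
    Squarefree (q / Nat.lcm r₁ r₂) ∧ (q / Nat.lcm r₁ r₂).Coprime (Nat.lcm r₁ r₂) := by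
  set r₄ := Nat.lcm r₁ r₂
  have h₄ : r₄ ∣ q := Nat.lcm_dvd h₁ h₂
  obtain ⟨k, hk⟩ := h₄
  have hr₁ : r₁ ∣ r₄ := Nat.dvd_lcm_left r₁ r₂
  have hr₂ : r₂ ∣ r₄ := Nat.dvd_lcm_right r₁ r₂
  rcases Nat.eq_zero_or_pos r₄ with h0 | hpos
  · -- degenerate: `r₄ = 0` forces `q = 0`
    have : q = 0 := by rw [hk, h0, zero_mul]
    subst this
    simp at hc₁
  have hkq : q / r₄ = k := by rw [hk, Nat.mul_div_cancel_left k hpos]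
  rw [hkq]
  have hk₁ : k ∣ q / r₁ := by
    rw [hk, mul_comm, Nat.mul_div_assoc k hr₁]; exact dvd_mul_right k _
  have hk₂ : k ∣ q / r₂ := by
    rw [hk, mul_comm, Nat.mul_div_assoc k hr₂]; exact dvd_mul_right k _
  refine ⟨hc₁.1.squarefree_of_dvd hk₁, ?_⟩
  have c₁ : k.Coprime r₁ := Nat.Coprime.coprime_dvd_left hk₁ hc₁.2
  have c₂ : k.Coprime r₂ := Nat.Coprime.coprime_dvd_left hk₂ hc₂.2
  exact Nat.Coprime.coprime_dvd_right (lcm_dvd_mul r₁ r₂) (Nat.Coprime.mul_right c₁ c₂)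

end Lemma55

section Lemma55Final

/-- **LEMMA 5.5, one modulus** (Montgomery–Vaughan 1975, pp. 360–361): for primitive `χ₁ mod r₁`,
`χ₂ mod r₂`, `m ≥ 1`, `r₄ = [r₁, r₂]`, `r₅ = (r₄, m)`, and `q = r₄ k`,
`φ(q)⁻² |c_{χ₁χ₂χ₀}(m) τ(χ̄₁χ₀) τ(χ̄₂χ₀)| ≤ 4 ∏_{p ∣ r₅} p/(p-1) · F(k)`,
`F(k) = [k squarefree, (k, r₄) = 1] φ(k)⁻¹ φ(k/(k,m))⁻¹` (`lemma55Weight`); the term vanishes unless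
`r₄ ∣ q`.  Ingredients as printed: LEMMA 5.4 for `|c|` (`≤ [r₃ ∣ q₁] φ(q)/φ(q₁) r₃^{1/2}`, `r₃` the
conductor of `χ₁χ₂χ₀`, `r₃ ∣ r₄`), LEMMA 5.2 for `|τ(χ̄ᵢχ₀)| = rᵢ^{1/2} [q/rᵢ squarefree, coprime to rᵢ]`,
whence `(k, r₄) = 1`, `μ(k)² = 1`, `φ(q) = φ(r₄)φ(k)`, `φ(q₁) = φ(r₄/r₅) φ(k/(k,m))`, `r₃ ∣ r₄/r₅`, and
the bound `(r₁r₂r₃)^{1/2} φ(r₄)⁻¹ φ(r₄/r₅)⁻¹ ≤ 4 ∏_{p ∣ r₅}(1 - 1/p)⁻¹` (`lemma55_moduli`).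
[cite: MontgomeryVaughanActa1975, §5 Lemma 5.5 (5.5)] -/
theorem lemma55Term_le {r₁ r₂ : ℕ} [NeZero r₁] [NeZero r₂] {ψ₁ : DirichletCharacter ℂ r₁}
    {ψ₂ : DirichletCharacter ℂ r₂} (hψ₁ : ψ₁.IsPrimitive) (hψ₂ : ψ₂.IsPrimitive) {m : ℕ}
    (hm : m ≠ 0) (q : ℕ) :
    lemma55Term ψ₁ ψ₂ m q ≤
      4 * (∏ p ∈ (Nat.gcd (Nat.lcm r₁ r₂) m).primeFactors, ((p : ℝ) / ((p : ℝ) - 1))) *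
        (if Nat.lcm r₁ r₂ ∣ q then lemma55Weight (Nat.lcm r₁ r₂) m (q / Nat.lcm r₁ r₂) else 0) := by
  set r₄ := Nat.lcm r₁ r₂ with hr₄
  set r₅ := Nat.gcd r₄ m with hr₅
  set r₆ := r₄ / r₅ with hr₆
  have hr₁0 : r₁ ≠ 0 := NeZero.ne r₁
  have hr₂0 : r₂ ≠ 0 := NeZero.ne r₂
  have h₄0 : r₄ ≠ 0 := Nat.lcm_ne_zero hr₁0 hr₂0
  have hP5 : 0 ≤ ∏ p ∈ r₅.primeFactors, ((p : ℝ) / ((p : ℝ) - 1)) :=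
    Finset.prod_nonneg fun p hp => by
      have hp2 : (2 : ℝ) ≤ p := by exact_mod_cast (Nat.prime_of_mem_primeFactors hp).two_le
      have : (0 : ℝ) < (p : ℝ) - 1 := by linarith
      positivity
  have hRHS0 : 0 ≤ 4 * (∏ p ∈ r₅.primeFactors, ((p : ℝ) / ((p : ℝ) - 1))) *
      (if r₄ ∣ q then lemma55Weight r₄ m (q / r₄) else 0) := by
    have : 0 ≤ (if r₄ ∣ q then lemma55Weight r₄ m (q / r₄) else 0) := by
      split_ifs
      · exact lemma55Weight_nonneg _ _ _
      · exact le_rfl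
    positivity
  unfold lemma55Term
  by_cases h : r₁ ∣ q ∧ r₂ ∣ q ∧ q ≠ 0
  swap
  · rw [dif_neg h]; exact hRHS0
  rw [dif_pos h]
  obtain ⟨h₁, h₂, hq0⟩ := h
  haveI : NeZero q := ⟨hq0⟩
  have h₄q : r₄ ∣ q := Nat.lcm_dvd h₁ h₂
  rw [if_pos h₄q]
  set k := q / r₄ with hk
  have hqk : q = r₄ * k := (Nat.mul_div_cancel' h₄q).symm
  have hRHS0' : 0 ≤ 4 * (∏ p ∈ r₅.primeFactors, ((p : ℝ) / ((p : ℝ) - 1))) * lemma55Weight r₄ m k :=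
    mul_nonneg (by positivity) (lemma55Weight_nonneg _ _ _)
  -- the three factors
  set χ := DirichletCharacter.changeLevel h₁ ψ₁ * DirichletCharacter.changeLevel h₂ ψ₂ with hχ
  set r₃ := χ.conductor with hr₃
  haveI : NeZero r₃ := ⟨DirichletCharacter.conductor_ne_zero χ⟩
  have h₃₄ : r₃ ∣ r₄ := by
    have := DirichletCharacter.conductor_mul_dvd_lcm_conductor
      (DirichletCharacter.changeLevel h₁ ψ₁) (DirichletCharacter.changeLevel h₂ ψ₂)
    rwa [DirichletCharacter.conductor_changeLevel, DirichletCharacter.conductor_changeLevel,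
      (DirichletCharacter.isPrimitive_def ψ₁).mp hψ₁, (DirichletCharacter.isPrimitive_def ψ₂).mp hψ₂]
      at this
  have hc : ‖charGauss χ (m : ZMod q)‖ ≤ (if r₃ ∣ redMod q m then 1 else 0) *
      ((Nat.totient q / Nat.totient (redMod q m) : ℕ) : ℝ) * Real.sqrt r₃ := by
    have := norm_charGauss_changeLevel_le (χ.conductor_dvd_level) (χ.primitiveCharacter_isPrimitive)
      hm (q := q)
    rwa [DirichletCharacter.changeLevel_primitiveCharacter] at this
  have hτ₁ := norm_gaussSum_changeLevel_inv_le h₁ hψ₁ (q := q)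
  have hτ₂ := norm_gaussSum_changeLevel_inv_le h₂ hψ₂ (q := q)
  have hφq : (0 : ℝ) < (Nat.totient q : ℝ) := by
    exact_mod_cast Nat.totient_pos.mpr (Nat.pos_of_ne_zero hq0)
  -- combine
  have hT : ‖charGauss χ (m : ZMod q)‖ *
      ‖gaussSum (DirichletCharacter.changeLevel h₁ ψ₁)⁻¹ ZMod.stdAddChar‖ *
      ‖gaussSum (DirichletCharacter.changeLevel h₂ ψ₂)⁻¹ ZMod.stdAddChar‖ / (Nat.totient q : ℝ) ^ 2 ≤
      ((if r₃ ∣ redMod q m then 1 else 0) * ((Nat.totient q / Nat.totient (redMod q m) : ℕ) : ℝ) *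
        Real.sqrt r₃) * (Real.sqrt r₁ * (if Squarefree (q / r₁) ∧ (q / r₁).Coprime r₁ then 1 else 0)) *
        (Real.sqrt r₂ * (if Squarefree (q / r₂) ∧ (q / r₂).Coprime r₂ then 1 else 0)) /
        (Nat.totient q : ℝ) ^ 2 := by
    gcongr
  refine hT.trans ?_
  by_cases hkc : Squarefree k ∧ k.Coprime r₄
  swap
  · -- one of the Gauss sums vanishes
    have hzero : (if Squarefree (q / r₁) ∧ (q / r₁).Coprime r₁ then (1 : ℝ) else 0) *
        (if Squarefree (q / r₂) ∧ (q / r₂).Coprime r₂ then (1 : ℝ) else 0) = 0 := by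
      by_contra hne
      rcases mul_ne_zero_iff.mp hne with ⟨ha, hb⟩
      have hc₁ : Squarefree (q / r₁) ∧ (q / r₁).Coprime r₁ := by
        by_contra hh; exact ha (if_neg hh)
      have hc₂ : Squarefree (q / r₂) ∧ (q / r₂).Coprime r₂ := by
        by_contra hh; exact hb (if_neg hh)
      exact hkc (squarefree_coprime_cofactor h₁ h₂ hc₁ hc₂)
    have : ((if r₃ ∣ redMod q m then 1 else 0) * ((Nat.totient q / Nat.totient (redMod q m) : ℕ) : ℝ) *
        Real.sqrt r₃) * (Real.sqrt r₁ * (if Squarefree (q / r₁) ∧ (q / r₁).Coprime r₁ then 1 else 0)) *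
        (Real.sqrt r₂ * (if Squarefree (q / r₂) ∧ (q / r₂).Coprime r₂ then 1 else 0)) /
        (Nat.totient q : ℝ) ^ 2 =
        ((if r₃ ∣ redMod q m then 1 else 0) * ((Nat.totient q / Nat.totient (redMod q m) : ℕ) : ℝ) *
        Real.sqrt r₃) * Real.sqrt r₁ * Real.sqrt r₂ / (Nat.totient q : ℝ) ^ 2 *
        ((if Squarefree (q / r₁) ∧ (q / r₁).Coprime r₁ then (1 : ℝ) else 0) *
        (if Squarefree (q / r₂) ∧ (q / r₂).Coprime r₂ then (1 : ℝ) else 0)) := by ring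
    rw [this, hzero, mul_zero]
    exact hRHS0'
  -- main case: `k` squarefree, coprime to `r₄`
  obtain ⟨hksq, hkcop⟩ := hkc
  have hk0 : k ≠ 0 := hksq.ne_zero
  have hW : lemma55Weight r₄ m k = 1 / ((Nat.totient k : ℝ) * (Nat.totient (redMod k m) : ℝ)) := by
    rw [lemma55Weight_apply, if_pos (show Squarefree k ∧ k.Coprime r₄ from ⟨hksq, hkcop⟩)]
    rfl
  rw [hW]
  have hI₁ : (if Squarefree (q / r₁) ∧ (q / r₁).Coprime r₁ then (1 : ℝ) else 0) ≤ 1 := by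
    split_ifs <;> norm_num
  have hI₂ : (if Squarefree (q / r₂) ∧ (q / r₂).Coprime r₂ then (1 : ℝ) else 0) ≤ 1 := by
    split_ifs <;> norm_num
  have hI₁0 : (0 : ℝ) ≤ (if Squarefree (q / r₁) ∧ (q / r₁).Coprime r₁ then (1 : ℝ) else 0) := by
    split_ifs <;> norm_num
  have hI₂0 : (0 : ℝ) ≤ (if Squarefree (q / r₂) ∧ (q / r₂).Coprime r₂ then (1 : ℝ) else 0) := by
    split_ifs <;> norm_num
  set I₁ := (if Squarefree (q / r₁) ∧ (q / r₁).Coprime r₁ then (1 : ℝ) else 0) with hI₁def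
  set I₂ := (if Squarefree (q / r₂) ∧ (q / r₂).Coprime r₂ then (1 : ℝ) else 0) with hI₂def
  set I₃ := (if r₃ ∣ redMod q m then (1 : ℝ) else 0) with hI₃def
  -- positivity facts
  have hφk : (0 : ℝ) < Nat.totient k := by exact_mod_cast Nat.totient_pos.mpr (Nat.pos_of_ne_zero hk0)
  have hkm0 : redMod k m ≠ 0 := redMod_ne_zero hk0 hm
  have hφkm : (0 : ℝ) < Nat.totient (redMod k m) := by
    exact_mod_cast Nat.totient_pos.mpr (Nat.pos_of_ne_zero hkm0)
  have hRHS1 : 0 ≤ 4 * (∏ p ∈ r₅.primeFactors, ((p : ℝ) / ((p : ℝ) - 1))) *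
      (1 / ((Nat.totient k : ℝ) * (Nat.totient (redMod k m) : ℝ))) := by positivity
  by_cases h₃ : r₃ ∣ redMod q m
  swap
  · have hI₃0 : I₃ = 0 := if_neg h₃
    rw [hI₃0]
    simp only [zero_mul, zero_div]
    exact hRHS1
  have hI₃1 : I₃ = 1 := if_pos h₃
  rw [hI₃1, one_mul]
  -- arithmetic of `q = r₄ k`
  have hcop : r₄.Coprime k := hkcop.symm
  have hφ : Nat.totient q = Nat.totient r₄ * Nat.totient k := by rw [hqk, Nat.totient_mul hcop]
  obtain ⟨hred, hredcop⟩ := redMod_mul hcop m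
  have hred' : redMod q m = r₆ * redMod k m := by rw [hqk, hred]; rfl
  have hredcop' : r₆.Coprime (redMod k m) := hredcop
  have hφ₁ : Nat.totient (redMod q m) = Nat.totient r₆ * Nat.totient (redMod k m) := by
    rw [hred', Nat.totient_mul hredcop']
  have h₃₆ : r₃ ∣ r₆ := by
    rw [hred'] at h₃
    have hc3 : r₃.Coprime (redMod k m) :=
      Nat.Coprime.coprime_dvd_left h₃₄ (Nat.Coprime.coprime_dvd_right (redMod_dvd k m) hcop)
    exact hc3.dvd_of_dvd_mul_right h₃
  -- the moduli
  have hmod := lemma55_moduli hr₁0 hr₂0 hm h₃₄ h₃₆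
  have hφ₄ : (0 : ℝ) < Nat.totient r₄ := by exact_mod_cast Nat.totient_pos.mpr (Nat.pos_of_ne_zero h₄0)
  have h₅0 : r₅ ≠ 0 := Nat.gcd_ne_zero_right hm
  have h₆0 : r₆ ≠ 0 := (Nat.div_ne_zero_iff_of_dvd (Nat.gcd_dvd_left r₄ m)).mpr ⟨h₄0, h₅0⟩
  have hφ₆ : (0 : ℝ) < Nat.totient r₆ := by exact_mod_cast Nat.totient_pos.mpr (Nat.pos_of_ne_zero h₆0)
  set A : ℝ := Real.sqrt r₃ * Real.sqrt r₁ * Real.sqrt r₂ with hAdef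
  set Pr : ℝ := ∏ p ∈ r₅.primeFactors, ((p : ℝ) / ((p : ℝ) - 1)) with hPrdef
  have hA0 : 0 ≤ A := by positivity
  have hsqrt : A ≤ 4 * Pr * Nat.totient r₄ * Nat.totient r₆ := by
    have hsq : A ^ 2 ≤ (4 * Pr * Nat.totient r₄ * Nat.totient r₆) ^ 2 := by
      rw [hAdef, mul_pow, mul_pow, Real.sq_sqrt (by positivity), Real.sq_sqrt (by positivity),
        Real.sq_sqrt (by positivity)]
      have : ((r₁ * r₂ * r₃ : ℕ) : ℝ) = (r₃ : ℝ) * r₁ * r₂ := by push_cast; ring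
      rw [← this]
      refine hmod.trans_eq ?_
      rw [hPrdef]; ring
    exact (pow_le_pow_iff_left₀ hA0 (by positivity) two_ne_zero).mp hsq
  -- the quotient `φ(q)/φ(q₁)` as a real number
  have hN : ((Nat.totient q / Nat.totient (redMod q m) : ℕ) : ℝ) =
      (Nat.totient r₄ : ℝ) * Nat.totient k / ((Nat.totient r₆ : ℝ) * Nat.totient (redMod k m)) := by
    rw [Nat.cast_div (totient_redMod_dvd hm) (by rw [hφ₁]; push_cast; positivity), hφ, hφ₁]
    push_cast
    ring
  have hφq' : (Nat.totient q : ℝ) = (Nat.totient r₄ : ℝ) * Nat.totient k := by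
    rw [hφ]; push_cast; ring
  calc ((Nat.totient q / Nat.totient (redMod q m) : ℕ) : ℝ) * Real.sqrt r₃ *
        (Real.sqrt r₁ * I₁) * (Real.sqrt r₂ * I₂) / (Nat.totient q : ℝ) ^ 2
      ≤ ((Nat.totient q / Nat.totient (redMod q m) : ℕ) : ℝ) * Real.sqrt r₃ *
        (Real.sqrt r₁ * 1) * (Real.sqrt r₂ * 1) / (Nat.totient q : ℝ) ^ 2 := by
        gcongr
    _ = (A / ((Nat.totient r₄ : ℝ) * Nat.totient r₆)) *
          (1 / ((Nat.totient k : ℝ) * (Nat.totient (redMod k m) : ℝ))) := by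
        rw [hN, hφq', hAdef]
        field_simp
    _ ≤ (4 * Pr) * (1 / ((Nat.totient k : ℝ) * (Nat.totient (redMod k m) : ℝ))) := by
        gcongr
        rw [div_le_iff₀ (by positivity)]
        linarith [hsqrt]

end Lemma55Final

section Lemma55Sum

/-- `∏_{p ∣ m} p/(p-1) = m/φ(m)`. [folklore] -/
theorem prod_primeFactors_div_eq {m : ℕ} (hm : m ≠ 0) :
    ∏ p ∈ m.primeFactors, ((p : ℝ) / ((p : ℝ) - 1)) = (m : ℝ) / (Nat.totient m : ℝ) := by
  have h := Nat.totient_mul_prod_primeFactors m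
  have hφ : (0 : ℝ) < Nat.totient m := by exact_mod_cast Nat.totient_pos.mpr (Nat.pos_of_ne_zero hm)
  have hP : (0 : ℝ) < ∏ p ∈ m.primeFactors, ((p : ℝ) - 1) :=
    Finset.prod_pos fun p hp => by
      have : (2 : ℝ) ≤ p := by exact_mod_cast (Nat.prime_of_mem_primeFactors hp).two_le
      linarith
  have h' : (Nat.totient m : ℝ) * ∏ p ∈ m.primeFactors, (p : ℝ) =
      (m : ℝ) * ∏ p ∈ m.primeFactors, ((p : ℝ) - 1) := by
    have hcast : ∀ p ∈ m.primeFactors, (((p - 1 : ℕ)) : ℝ) = (p : ℝ) - 1 := fun p hp => by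
      rw [Nat.cast_sub (Nat.prime_of_mem_primeFactors hp).one_lt.le, Nat.cast_one]
    rw [← Finset.prod_congr rfl hcast]
    have := congrArg (fun n : ℕ => (n : ℝ)) h
    push_cast at this
    exact this
  rw [Finset.prod_div_distrib, div_eq_div_iff hP.ne' hφ.ne']
  linarith [h']

/-- `∏_{p ∣ (R, m)} p/(p-1) · ∏_{p ∣ m, p ∤ R} p/(p-1) ≤ m/φ(m)`. [folklore] -/
theorem prod_gcd_mul_prod_filter_le {R m : ℕ} (hm : m ≠ 0) :
    (∏ p ∈ (Nat.gcd R m).primeFactors, ((p : ℝ) / ((p : ℝ) - 1))) *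
      ∏ p ∈ m.primeFactors.filter (fun p => ¬ p ∣ R), ((p : ℝ) / ((p : ℝ) - 1)) ≤
      (m : ℝ) / (Nat.totient m : ℝ) := by
  have hone : ∀ p ∈ m.primeFactors, (1 : ℝ) ≤ (p : ℝ) / ((p : ℝ) - 1) := fun p hp => by
    have : (2 : ℝ) ≤ p := by exact_mod_cast (Nat.prime_of_mem_primeFactors hp).two_le
    rw [le_div_iff₀ (by linarith)]; linarith
  have hsub : (Nat.gcd R m).primeFactors ⊆ m.primeFactors.filter (fun p => p ∣ R) := by
    intro p hp
    obtain ⟨hpp, hpd, _⟩ := Nat.mem_primeFactors.mp hp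
    exact Finset.mem_filter.mpr ⟨Nat.mem_primeFactors.mpr ⟨hpp, hpd.trans (Nat.gcd_dvd_right R m), hm⟩,
      hpd.trans (Nat.gcd_dvd_left R m)⟩
  calc (∏ p ∈ (Nat.gcd R m).primeFactors, ((p : ℝ) / ((p : ℝ) - 1))) *
        ∏ p ∈ m.primeFactors.filter (fun p => ¬ p ∣ R), ((p : ℝ) / ((p : ℝ) - 1))
      ≤ (∏ p ∈ m.primeFactors.filter (fun p => p ∣ R), ((p : ℝ) / ((p : ℝ) - 1))) *
        ∏ p ∈ m.primeFactors.filter (fun p => ¬ p ∣ R), ((p : ℝ) / ((p : ℝ) - 1)) := by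
        refine mul_le_mul_of_nonneg_right ?_ (Finset.prod_nonneg fun p hp =>
          zero_le_one.trans (hone p (Finset.mem_filter.mp hp).1))
        exact prod_le_prod_of_subset_of_one_le_real hsub fun p hp => hone p (Finset.mem_filter.mp hp).1
    _ = ∏ p ∈ m.primeFactors, ((p : ℝ) / ((p : ℝ) - 1)) := Finset.prod_filter_mul_prod_filter_not _ _ _
    _ = (m : ℝ) / (Nat.totient m : ℝ) := prod_primeFactors_div_eq hm

/-- **LEMMA 5.5** (Montgomery–Vaughan 1975, p. 360): let `χᵢ` be primitive characters `(mod rᵢ)`,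
`i = 1, 2`.  Then for `m ≠ 0`,
(5.4) `∑_q φ(q)⁻² |c_{χ₁χ₂χ₀}(m) τ(χ̄₁χ₀) τ(χ̄₂χ₀)| ≪ |m|/φ(|m|)`,
the sum over all `q` divisible by both `r₁` and `r₂` (`χ₀` principal mod `q`); here over any finite
set of moduli, with the absolute constant `4e²`, for `m ≥ 1` (for `-m` use `|c_χ(-m)| = |c_χ(m)|`,
`norm_charGauss_neg`).  Proof as printed: per modulus `q = r₄k` the bound `lemma55Term_le`, then the
sum over squarefree `k` coprime to `r₄` (`sum_lemma55Weight_le`) and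
`∏_{p ∣ r₅} ∏_{p ∣ m, p ∤ r₄} (1-1/p)⁻¹ ≤ m/φ(m)`. [cite: MontgomeryVaughanActa1975, §5 Lemma 5.5 (5.4)] -/
theorem lemma55 {r₁ r₂ : ℕ} [NeZero r₁] [NeZero r₂] {ψ₁ : DirichletCharacter ℂ r₁}
    {ψ₂ : DirichletCharacter ℂ r₂} (hψ₁ : ψ₁.IsPrimitive) (hψ₂ : ψ₂.IsPrimitive) {m : ℕ}
    (hm : m ≠ 0) (S : Finset ℕ) :
    ∑ q ∈ S, lemma55Term ψ₁ ψ₂ m q ≤ 4 * Real.exp 2 * ((m : ℝ) / (Nat.totient m : ℝ)) := by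
  set r₄ := Nat.lcm r₁ r₂ with hr₄
  have h₄0 : r₄ ≠ 0 := Nat.lcm_ne_zero (NeZero.ne r₁) (NeZero.ne r₂)
  have h₄pos : 0 < r₄ := Nat.pos_of_ne_zero h₄0
  set Pr : ℝ := ∏ p ∈ (Nat.gcd r₄ m).primeFactors, ((p : ℝ) / ((p : ℝ) - 1)) with hPr
  have hPr0 : 0 ≤ Pr := Finset.prod_nonneg fun p hp => by
    have hp2 : (2 : ℝ) ≤ p := by exact_mod_cast (Nat.prime_of_mem_primeFactors hp).two_le
    have : (0 : ℝ) < (p : ℝ) - 1 := by linarith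
    positivity
  -- per modulus
  have h1 : ∑ q ∈ S, lemma55Term ψ₁ ψ₂ m q ≤
      ∑ q ∈ S, 4 * Pr * (if r₄ ∣ q then lemma55Weight r₄ m (q / r₄) else 0) :=
    Finset.sum_le_sum fun q _ => lemma55Term_le hψ₁ hψ₂ hm q
  refine h1.trans ?_
  rw [← Finset.mul_sum, ← Finset.sum_filter]
  -- reindex `q = r₄ k`
  set N := S.sup id + 1 with hN
  have h2 : ∑ q ∈ S.filter (fun q => r₄ ∣ q), lemma55Weight r₄ m (q / r₄) ≤
      ∑ k ∈ Finset.range N, lemma55Weight r₄ m k := by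
    rw [← Finset.sum_image (f := fun k => lemma55Weight r₄ m k) (s := S.filter (fun q => r₄ ∣ q))
      (g := fun q => q / r₄) ?_]
    · refine Finset.sum_le_sum_of_subset_of_nonneg ?_ fun k _ _ => lemma55Weight_nonneg _ _ _
      intro k hk
      obtain ⟨q, hq, rfl⟩ := Finset.mem_image.mp hk
      have hqS : q ∈ S := (Finset.mem_filter.mp hq).1
      have : q ≤ S.sup id := Finset.le_sup (f := id) hqS
      exact Finset.mem_range.mpr (lt_of_le_of_lt ((Nat.div_le_self q r₄).trans this) (Nat.lt_succ_self _))
    · intro q hq q' hq' h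
      have hd : r₄ ∣ q := (Finset.mem_filter.mp hq).2
      have hd' : r₄ ∣ q' := (Finset.mem_filter.mp hq').2
      exact (Nat.div_left_inj hd hd').mp h
  calc 4 * Pr * ∑ q ∈ S.filter (fun q => r₄ ∣ q), lemma55Weight r₄ m (q / r₄)
      ≤ 4 * Pr * (Real.exp 2 * ∏ p ∈ m.primeFactors.filter (fun p => ¬ p ∣ r₄), ((p : ℝ) / ((p : ℝ) - 1))) := by
        gcongr
        exact h2.trans (sum_lemma55Weight_le r₄ hm N)
    _ = 4 * Real.exp 2 * (Pr * ∏ p ∈ m.primeFactors.filter (fun p => ¬ p ∣ r₄), ((p : ℝ) / ((p : ℝ) - 1))) := by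
        ring
    _ ≤ 4 * Real.exp 2 * ((m : ℝ) / (Nat.totient m : ℝ)) := by
        gcongr
        exact prod_gcd_mul_prod_filter_le hm

/-- `c_χ(-a) = χ(-1) c_χ(a)` (substitute `h ↦ -h`). [folklore] -/
theorem charGauss_neg {q : ℕ} [NeZero q] (χ : DirichletCharacter ℂ q) (a : ZMod q) :
    charGauss χ (-a) = χ (-1) * charGauss χ a := by
  rw [charGauss_eq_sum, charGauss_eq_sum, Finset.mul_sum]
  refine Fintype.sum_equiv (Equiv.neg (ZMod q)) _ _ fun x => ?_
  simp only [Equiv.neg_apply]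
  rw [show (-a) * x = a * (-x) by ring, show χ x = χ (-1) * χ (-x) by
    rw [← map_mul, show (-1 : ZMod q) * -x = x by ring]]
  ring

/-- `|c_χ(-a)| = |c_χ(a)|`. [folklore] -/
theorem norm_charGauss_neg {q : ℕ} [NeZero q] (χ : DirichletCharacter ℂ q) (a : ZMod q) :
    ‖charGauss χ (-a)‖ = ‖charGauss χ a‖ := by
  rw [charGauss_neg, norm_mul]
  have : ‖χ (-1)‖ = 1 := by
    have hu : IsUnit (-1 : ZMod q) := isUnit_one.neg
    rw [← hu.unit_spec]
    exact χ.unit_norm_eq_one hu.unit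
  rw [this, one_mul]

end Lemma55Sum

end Literature.NumberTheory.Sieve.MontgomeryVaughan1975
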